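import Literature.NumberTheory.Transcendental.HyperlogarithmsGeneralIntegrals
import Literature.NumberTheory.Transcendental.HyperlogarithmsCubicalFamily
import Literature.NumberTheory.Transcendental.GenusZeroPeriodsMZV
import Mathlib.RingTheory.MvPolynomial.Tower
import HarnessLib

/-!
# Brown's theorem `GenusZeroPeriodsMZV`: the proof

This file discharges the named fact `Literature.NumberTheory.Transcendental.GenusZeroPeriodsMZV`
(F. Brown, *Multiple zeta values and periods of moduli spaces `𝔐̄_{0,n}`*, Ann. Sci. ÉNS 42 (2009),
Thm 1.1 / Cor 8.3, real single-cell form): `theorem GenusZeroPeriodsMZV_holds`.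

## The argument (Brown 2009, §8.3, Thm 8.2, in cubical coordinates)

Brown proves Thm 8.2 by integrating out one coordinate at a time along the fibrations
`𝔐_{0,n} → 𝔐_{0,n-1}`: the fibre integral of a generalised polylogarithm with convergent
coefficients is, by the hyperlogarithm calculus (primitives, Thm 6.25 for the regularised values at
the endpoints), again such an object one level down, with multiple zeta values of controlled weight
as new coefficients.  We run this mechanism in the cubical coordinates `t_i = x_0 x_1 ⋯ x_i` of the
standard cell (Brown 2009, §2.2), which carry `{1 > t_0 > ⋯ > t_{ℓ-1} > 0}` onto the open cube
`(0,1)^ℓ` with Jacobian `∏_k x_k^{ℓ-1-k}`; every regular function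
`P(t)/(∏ t_i^{b_i} ∏ (1-t_i)^{c_i} ∏_{i<j}(t_i-t_j)^{a_ij})` becomes an element of the `ℚ`-algebra
`𝒢_ℓ` generated by the `x_k^{±1}` and the `1/(1 - x_a ⋯ x_{b-1})` (`a < b ≤ ℓ`), because
`t_i - t_j = t_i (1 - x_{i+1} ⋯ x_j)`.

* **Levels.** The coordinate `x_n` sees the alphabet `σ_n = {0, 1, 1/(x_a ⋯ x_{n-1}) : a < n}`
  (`σL n`, letters `Let (Fin n)` of layer XII), whose letters, inverses and inverse differences lie
  in `𝒢_n` (`σL_mem`, `σL_inv_mem`, `σL_diff_inv_mem`: `1/(1 - x_a⋯x_{n-1})` is the letter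
  `1/(x_a⋯x_{n-2})` of level `n-1` times the basis function `1/(1/(x_a⋯x_{n-2}) - x_{n-1})`).
  `𝒢_n` (`𝒢L n`) is generated by the admissible basis functions `x_k^j, x_k^{-j-1},
  (σ - x_k)^{-j-1}` (`σ ∈ σ_k ∖ 0`) of all levels `k < n` (`atom`), so that (**peeling**, `peel`)
  every `g ∈ 𝒢_{m+1}` is a combination of level-`m` basis functions of `x_m` with coefficients in
  `𝒢_m` (products inside the class: `mulBF`, `bevG_mulBF`).
* **One integration** (`step`). A *family element* of level `m+1` and weight `w` is a finite sum
  `Σ F_{β,u} b_β(t) L_u(t; σ_{m+1})` with `F_{β,u} ∈ M_{m+1}^{(w-|u|)}`, where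
  `M_n^{(k)} = span_ℚ {ζ · g : ζ ∈ 𝒵_{≤k}, g ∈ 𝒢_n}` (`Mw`, `WtIn`).  Theorem F₁ for families
  (layer XIII, `integral_hevG_family`) integrates it over `t ∈ (0,1)` to
  `Σ_v (outA F)_v L_v(1; σ_{m+1})` with `(outA F)_v ∈ M_{m+1}^{(w+1-|v|)}` (`outA_mem_mw`) and
  `v` doubly shuffle-regular; Theorem T4 with coefficients (layer XII), in its parameter-uniform
  form `exists_universal_expansion`/`uexp` (the expansion does not depend on the parameters and its
  words are not longer than `v`, `suppLen_uexp`), rewrites `L_v(1; σ_{m+1})` — note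
  `σ_{m+1} = σf (πL m) (x_m)` (`σat_σL_succ`) — as `Σ_U (E_v)_U L_{U}(x_m; σ_m)` with
  `(E_v)_U ∈ 𝒵_{≤ |v|-|U|}` after relabelling the letters (`hlogSeries_map`, `ιL`); weighted
  peeling of the coefficients (`wpeel`) then produces a family element of level `m` and weight
  `w+1` with the same integrand (`transfer`, `evW_transfer`).
* **Recursion** (`recursion`): Fubini over the last coordinate (`MeasurableEquiv.piFinSuccAbove`,
  a.e. integrability of the slices) and induction on the level; at level `0` the alphabet is
  `{0,1}`, the values at `1` are multiple zeta values (`hlogAt1_σL_zero_mem`) and the coefficients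
  are constants in `𝒵_{≤k}` (`apply_mem_fil_of_mem_mw_zero`), so an integrable family element of
  level `n` and weight `w` integrates over `(0,1)^{n+1}` into `𝒵_{≤ w+n+1}`; the stuffle product
  (`mem_mzvSpace_mul_holds`) multiplies the weights (`fil_mul_mem`).
* **Assembly**: the change of variables (`φc`, `φc_image`, `det_φc'`,
  `integral_simplex_eq_integral_cube` via `integral_image_eq_integral_abs_det_fderiv_smul`), the
  membership of the transported integrand in `𝒢_ℓ` (`GInt_mem`, `GInt_ext`), peeling into a family
  element of level `ℓ-1` and weight `0` with empty words (`integral_cube_mem`), and the trivial case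
  `ℓ = 0` give `Hyperlog.genusZeroPeriodsMZV_proof`.

Everything is proved; no named fact is introduced.  (Absolute convergence enters only through
Fubini: the fibre integrals that occur are a.e. absolutely convergent, which is all that Theorem F₁
needs; Brown's Lemma 7.4 — the combinatorial description of convergence — is thereby bypassed.)

## References

* F. C. S. Brown, *Multiple zeta values and periods of moduli spaces `𝔐̄_{0,n}`*, Ann. Sci. Éc.
  Norm. Supér. (4) 42 (2009), 371–489: §2.2 (cubical coordinates), §5.3, §6.3 (Thm 6.25), §8.3
  (Thm 8.2), Thm 1.1, Cor 8.3. doi:10.24033/asens.2099. [BrownENS2009]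
* A. B. Goncharov, Yu. I. Manin, *Multiple ζ-motives and moduli spaces `𝔐̄_{0,n}`*, Compos. Math.
  140 (2004), 1–14 (the conjecture).
-/

noncomputable section

open MeasureTheory intervalIntegral Set Filter
open scoped BigOperators Topology

namespace Literature.NumberTheory.Transcendental

namespace Hyperlog

variable {α : Type*}


/-! ### Products of basis functions: the class is an algebra over the coefficient functions -/

section Products

variable [DecidableEq α]

/-- The table `b_β · t`. [folklore] -/
def mulTB {K : Type*} [CommRing K] (σ : α → K) : GB α → GB α →₀ K
  | GB.pow k => Finsupp.single (GB.pow (k + 1)) 1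
  | GB.invPow 0 => Finsupp.single (GB.pow 0) 1
  | GB.invPow (k + 1) => Finsupp.single (GB.invPow k) 1
  | GB.invLet a 0 => σ a • Finsupp.single (GB.invLet a 0) 1 - Finsupp.single (GB.pow 0) 1
  | GB.invLet a (k + 1) => σ a • Finsupp.single (GB.invLet a (k + 1)) 1 - Finsupp.single (GB.invLet a k) 1

omit [DecidableEq α] in
/-- The table `b_β · t` is correct on `(0,1)`. [folklore] -/
theorem bvalG_mul_self {σ : α → ℝ} (hσ : ∀ c, σ c = 0 ∨ 1 ≤ σ c) (β : GB α) {t : ℝ} (ht : t ∈ Ioo (0 : ℝ) 1) :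
    bvalG σ β t * t = bevG σ (mulTB σ β) t := by
  have ht0 : t ≠ 0 := ht.1.ne'
  cases β with
  | pow k => simp only [mulTB, bevG_single, bvalG]; ring
  | invPow k =>
    cases k with
    | zero => simp only [mulTB, bevG_single, bvalG]; field_simp; ring
    | succ k => simp only [mulTB, bevG_single, bvalG]; field_simp; ring
  | invLet a k =>
    have hat : σ a - t ≠ 0 := sub_ne_zero_of_adm hσ a ht
    cases k with
    | zero => simp only [mulTB, bevG_sub, bevG_smul, bevG_single, bvalG]; field_simp; ring
    | succ k => simp only [mulTB, bevG_sub, bevG_smul, bevG_single, bvalG]; field_simp; ring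

/-- Multiplication of a combination by `t`. [folklore] -/
def mulTF {K : Type*} [CommRing K] (σ : α → K) (Φ : GB α →₀ K) : GB α →₀ K := Φ.sum fun β q => q • mulTB σ β

/-- Multiplication of a combination by the density `ρ_c`. [folklore] -/
def mulCF {K : Type*} [CommRing K] [Inv K] (σ : α → K) (c : α) (Φ : GB α →₀ K) : GB α →₀ K :=
  Φ.sum fun β q => q • mulG σ β c

/-- **Multiplication of a combination by a basis function** (`z` a letter at `0`, so that `ρ_z = 1/t`,
and `ρ_a = 1/(σ_a - t)`): iterated tables. [folklore] -/
def mulBF {K : Type*} [CommRing K] [Inv K] (σ : α → K) (z : α) (Φ : GB α →₀ K) : GB α → GB α →₀ K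
  | GB.pow 0 => Φ
  | GB.pow (k + 1) => mulTF σ (mulBF σ z Φ (GB.pow k))
  | GB.invPow 0 => mulCF σ z Φ
  | GB.invPow (k + 1) => mulCF σ z (mulBF σ z Φ (GB.invPow k))
  | GB.invLet a 0 => mulCF σ a Φ
  | GB.invLet a (k + 1) => mulCF σ a (mulBF σ z Φ (GB.invLet a k))

/-- Admissibility of all basis elements of a combination. [folklore] -/
def GBF.ok {K : Type*} [Zero K] (σ : α → K) (Φ : GB α →₀ K) : Prop := ∀ β ∈ Φ.support, GB.ok σ β

omit [DecidableEq α] in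
/-- Supports of linear extensions. [folklore] -/
theorem ok_sum_smul {K : Type*} [CommRing K] {σ : α → K} (Φ : GB α →₀ K) (T : GB α → GB α →₀ K)
    (hT : ∀ β ∈ Φ.support, ∀ γ ∈ (T β).support, GB.ok σ γ) : GBF.ok σ (Φ.sum fun β q => q • T β) := by
  classical
  intro γ hγ
  obtain ⟨β, hβ, hβγ⟩ := Finset.mem_biUnion.1 (Finsupp.support_finsetSum hγ)
  exact hT β hβ γ (Finsupp.support_smul hβγ)

omit [DecidableEq α] in
/-- The table `· t` preserves admissibility. [folklore] -/
theorem mulTB_ok {K : Type*} [CommRing K] {σ : α → K} (β : GB α) (hβ : GB.ok σ β) : ∀ γ ∈ (mulTB σ β).support, GB.ok σ γ := by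
  classical
  have hs : ∀ (γ δ : GB α) (r : K), γ ∈ (Finsupp.single δ r).support → γ = δ := fun γ δ r h =>
    Finset.mem_singleton.1 (Finsupp.support_single_subset h)
  intro γ hγ
  cases β with
  | pow k => rw [hs _ _ _ hγ]; trivial
  | invPow k =>
    cases k with
    | zero => rw [hs _ _ _ hγ]; trivial
    | succ k => rw [hs _ _ _ hγ]; trivial
  | invLet a k =>
    cases k with
    | zero =>
      simp only [mulTB] at hγ
      rw [sub_eq_add_neg] at hγ
      rcases Finset.mem_union.1 (Finsupp.support_add hγ) with h | h
      · rw [hs _ _ _ (Finsupp.support_smul h)]; exact hβ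
      · rw [Finsupp.support_neg] at h; rw [hs _ _ _ h]; trivial
    | succ k =>
      simp only [mulTB] at hγ
      rw [sub_eq_add_neg] at hγ
      rcases Finset.mem_union.1 (Finsupp.support_add hγ) with h | h
      · rw [hs _ _ _ (Finsupp.support_smul h)]; exact hβ
      · rw [Finsupp.support_neg] at h; rw [hs _ _ _ h]; exact hβ

omit [DecidableEq α] in
/-- `mulTF` preserves admissibility. [folklore] -/
theorem mulTF_ok {K : Type*} [CommRing K] {σ : α → K} {Φ : GB α →₀ K} (hΦ : GBF.ok σ Φ) : GBF.ok σ (mulTF σ Φ) :=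
  ok_sum_smul Φ _ fun β hβ => mulTB_ok β (hΦ β hβ)

omit [DecidableEq α] in
/-- `mulCF` preserves admissibility. [folklore] -/
theorem mulCF_ok {K : Type*} [CommRing K] [Inv K] {σ : α → K} (c : α) {Φ : GB α →₀ K} (hΦ : GBF.ok σ Φ) :
    GBF.ok σ (mulCF σ c Φ) :=
  ok_sum_smul Φ _ fun β hβ => mulG_ok β (hΦ β hβ) c

omit [DecidableEq α] in
/-- `mulBF` preserves admissibility. [folklore] -/
theorem mulBF_ok {K : Type*} [CommRing K] [Inv K] {σ : α → K} (z : α) {Φ : GB α →₀ K} (hΦ : GBF.ok σ Φ) :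
    ∀ γ : GB α, GBF.ok σ (mulBF σ z Φ γ)
  | GB.pow 0 => by simp only [mulBF]; exact hΦ
  | GB.pow (k + 1) => by simp only [mulBF]; exact mulTF_ok (mulBF_ok z hΦ (GB.pow k))
  | GB.invPow 0 => by simp only [mulBF]; exact mulCF_ok z hΦ
  | GB.invPow (k + 1) => by simp only [mulBF]; exact mulCF_ok z (mulBF_ok z hΦ (GB.invPow k))
  | GB.invLet a 0 => by simp only [mulBF]; exact mulCF_ok a hΦ
  | GB.invLet a (k + 1) => by simp only [mulBF]; exact mulCF_ok a (mulBF_ok z hΦ (GB.invLet a k))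

variable {σ : α → ℝ} {z : α} (hz : σ z = 0) (hσz : ∀ c, c ≠ z → 1 ≤ σ c)
include hz hσz

omit [DecidableEq α] in
/-- `mulTF` is correct. [folklore] -/
theorem bevG_mulTF (Φ : GB α →₀ ℝ) {t : ℝ} (ht : t ∈ Ioo (0 : ℝ) 1) : bevG σ (mulTF σ Φ) t = bevG σ Φ t * t := by
  unfold mulTF
  rw [bevG_finsupp_sum]
  simp only [bevG_smul, ← bvalG_mul_self (adm_of_zero_letter σ hz hσz) _ ht]
  unfold bevG
  simp only [Finsupp.sum, Finset.sum_mul, mul_assoc]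

omit [DecidableEq α] in
/-- `mulCF` is correct. [folklore] -/
theorem bevG_mulCF (c : α) {Φ : GB α →₀ ℝ} (hΦ : GBF.ok σ Φ) {t : ℝ} (ht : t ∈ Ioo (0 : ℝ) 1) :
    bevG σ (mulCF σ c Φ) t = bevG σ Φ t * pden σ c t := by
  unfold mulCF
  rw [bevG_finsupp_sum]
  simp only [bevG_smul]
  rw [Finsupp.sum, bevG, Finsupp.sum, Finset.sum_mul]
  refine Finset.sum_congr rfl fun β hβ => ?_
  rw [← bvalG_mul_pden (adm_of_zero_letter σ hz hσz) β (hΦ β hβ) c ht]; ring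

/-- The densities are basis functions: `ρ_z = t⁻¹`, `ρ_a = (σ_a - t)⁻¹`. [folklore] -/
theorem pden_eq_bvalG (c : α) {t : ℝ} (ht : t ∈ Ioo (0 : ℝ) 1) :
    pden σ c t = if c = z then bvalG σ (GB.invPow 0) t else bvalG σ (GB.invLet c 0) t := by
  by_cases hc : c = z
  · subst hc; rw [if_pos rfl, pden_of_eq_zero hz ht.1]; simp [bvalG]
  · rw [if_neg hc, pden_of_ne_zero (adm_of_zero_letter σ hz hσz) (by have := hσz c hc; linarith) ht.2]
    simp [bvalG]

/-- **`mulBF` is correct**: `bevG (mulBF Φ γ) t = bevG Φ t · b_γ(t)`. [folklore] -/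
theorem bevG_mulBF {Φ : GB α →₀ ℝ} (hΦ : GBF.ok σ Φ) {t : ℝ} (ht : t ∈ Ioo (0 : ℝ) 1) :
    ∀ {γ : GB α}, GB.ok σ γ → bevG σ (mulBF σ z Φ γ) t = bevG σ Φ t * bvalG σ γ t
  | GB.pow 0, _ => by simp [mulBF, bvalG]
  | GB.pow (k + 1), _ => by
    simp only [mulBF]
    rw [bevG_mulTF hz hσz _ ht, bevG_mulBF hΦ ht (γ := GB.pow k) trivial]
    simp only [bvalG]; ring
  | GB.invPow 0, _ => by
    simp only [mulBF]
    rw [bevG_mulCF hz hσz z hΦ ht, pden_eq_bvalG hz hσz z ht, if_pos rfl]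
  | GB.invPow (k + 1), _ => by
    simp only [mulBF]
    rw [bevG_mulCF hz hσz z (mulBF_ok z hΦ _) ht, bevG_mulBF hΦ ht (γ := GB.invPow k) trivial,
      pden_eq_bvalG hz hσz z ht, if_pos rfl]
    have ht0 : t ≠ 0 := ht.1.ne'
    simp only [bvalG]; field_simp; ring
  | GB.invLet a 0, ha => by
    have haz : a ≠ z := fun h => ha (by rw [h, hz])
    simp only [mulBF]
    rw [bevG_mulCF hz hσz a hΦ ht, pden_eq_bvalG hz hσz a ht, if_neg haz]
  | GB.invLet a (k + 1), ha => by
    have haz : a ≠ z := fun h => ha (by rw [h, hz])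
    have hat : σ a - t ≠ 0 := sub_ne_zero_of_adm (adm_of_zero_letter σ hz hσz) a ht
    simp only [mulBF]
    rw [bevG_mulCF hz hσz a (mulBF_ok z hΦ _) ht, bevG_mulBF hΦ ht (γ := GB.invLet a k) ha,
      pden_eq_bvalG hz hσz a ht, if_neg haz]
    simp only [bvalG]; field_simp; ring

end Products

/-! ### Products for families: commutation with evaluation and membership -/

section ProductsFamily

variable [DecidableEq α] {D : Type*} {σA : α → D → ℝ} (z : α)
  (hZu : ∀ c, σA c = 0 ∨ ∀ r, σA c r ≠ 0) (hEu : ∀ a c, σA c = σA a ∨ ∀ r, σA c r ≠ σA a r)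
  (𝒢 : Subalgebra ℚ (D → ℝ))
  (hGσ : ∀ a, σA a ∈ 𝒢) (hGinv : ∀ a, σA a ≠ 0 → (σA a)⁻¹ ∈ 𝒢)
  (hGdiff : ∀ a c, σA c ≠ σA a → (σA c - σA a)⁻¹ ∈ 𝒢)

omit [DecidableEq α] in
/-- Evaluation commutes with the table `· t`. [folklore] -/
theorem evF_mulTB (r : D) (β : GB α) : evF r (mulTB σA β) = mulTB (σat σA r) β := by
  cases β with
  | pow k => simp [mulTB]
  | invPow k => cases k <;> simp [mulTB]
  | invLet a k =>
    cases k with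
    | zero => simp only [mulTB, map_sub, evF_smul, evF_single]; rfl
    | succ k => simp only [mulTB, map_sub, evF_smul, evF_single]; rfl

omit [DecidableEq α] in
/-- Evaluation of a linear extension. [folklore] -/
theorem evF_sum_smul (r : D) (Φ : GB α →₀ (D → ℝ)) (T : GB α → GB α →₀ (D → ℝ)) (T' : GB α → GB α →₀ ℝ)
    (hT : ∀ β, evF r (T β) = T' β) :
    evF r (Φ.sum fun β q => q • T β) = (evF r Φ).sum fun β q => q • T' β := by
  rw [evF_finsupp_sum]
  unfold evF
  rw [Finsupp.mapRange.addMonoidHom_apply, Finsupp.sum_mapRange_index (fun _ => by simp)]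
  refine Finsupp.sum_congr fun β _ => ?_
  have := hT β
  unfold evF at this
  rw [← this]
  ext x; simp

omit [DecidableEq α] in
/-- Evaluation commutes with `mulTF`. [folklore] -/
theorem evF_mulTF (r : D) (Φ : GB α →₀ (D → ℝ)) : evF r (mulTF σA Φ) = mulTF (σat σA r) (evF r Φ) :=
  evF_sum_smul r Φ _ _ (evF_mulTB r)

include hZu hEu in
omit [DecidableEq α] in
/-- Evaluation commutes with `mulCF`. [folklore] -/
theorem evF_mulCF (r : D) (c : α) (Φ : GB α →₀ (D → ℝ)) : evF r (mulCF σA c Φ) = mulCF (σat σA r) c (evF r Φ) :=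
  evF_sum_smul r Φ _ _ (fun β => evF_mulG hZu hEu r β c)

include hZu hEu in
omit [DecidableEq α] in
/-- Evaluation commutes with `mulBF`. [folklore] -/
theorem evF_mulBF (r : D) (Φ : GB α →₀ (D → ℝ)) :
    ∀ γ : GB α, evF r (mulBF σA z Φ γ) = mulBF (σat σA r) z (evF r Φ) γ
  | GB.pow 0 => by simp only [mulBF]
  | GB.pow (k + 1) => by simp only [mulBF]; rw [evF_mulTF, evF_mulBF r Φ (GB.pow k)]
  | GB.invPow 0 => by simp only [mulBF]; rw [evF_mulCF hZu hEu]
  | GB.invPow (k + 1) => by simp only [mulBF]; rw [evF_mulCF hZu hEu, evF_mulBF r Φ (GB.invPow k)]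
  | GB.invLet a 0 => by simp only [mulBF]; rw [evF_mulCF hZu hEu]
  | GB.invLet a (k + 1) => by simp only [mulBF]; rw [evF_mulCF hZu hEu, evF_mulBF r Φ (GB.invLet a k)]

include hGσ in
/-- The coefficients of the table `· t` lie in `𝒢`. [folklore] -/
theorem coefIn_mulTB (β : GB α) : CoefIn 𝒢 (mulTB σA β) := by
  have h1 : (1 : D → ℝ) ∈ 𝒢 := Subalgebra.one_mem _
  cases β with
  | pow k => exact coefIn_single 𝒢 _ h1
  | invPow k =>
    cases k with
    | zero => exact coefIn_single 𝒢 _ h1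
    | succ k => exact coefIn_single 𝒢 _ h1
  | invLet a k =>
    cases k with
    | zero => exact ((coefIn_single 𝒢 _ h1).smul 𝒢 (hGσ a)).sub 𝒢 (coefIn_single 𝒢 _ h1)
    | succ k => exact ((coefIn_single 𝒢 _ h1).smul 𝒢 (hGσ a)).sub 𝒢 (coefIn_single 𝒢 _ h1)

include hGσ in
/-- `mulTF` preserves membership. [folklore] -/
theorem coefIn_mulTF {Φ : GB α →₀ (D → ℝ)} (hΦ : CoefIn 𝒢 Φ) : CoefIn 𝒢 (mulTF σA Φ) :=
  coefIn_finsupp_sum 𝒢 hΦ fun β _ hf => (coefIn_mulTB 𝒢 hGσ β).smul 𝒢 hf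

include hGσ hGinv hGdiff in
/-- `mulCF` preserves membership (for admissible combinations). [folklore] -/
theorem coefIn_mulCF (c : α) {Φ : GB α →₀ (D → ℝ)} (hok : GBF.ok σA Φ) (hΦ : CoefIn 𝒢 Φ) : CoefIn 𝒢 (mulCF σA c Φ) := by
  unfold mulCF
  rw [Finsupp.sum]
  exact coefIn_finset_sum 𝒢 _ fun β hβ => (coefIn_mulG 𝒢 hGσ hGinv hGdiff β (hok β hβ) c).smul 𝒢 (hΦ β)

include hGσ hGinv hGdiff in
/-- `mulBF` preserves membership (for admissible combinations). [folklore] -/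
theorem coefIn_mulBF {Φ : GB α →₀ (D → ℝ)} (hok : GBF.ok σA Φ) (hΦ : CoefIn 𝒢 Φ) :
    ∀ γ : GB α, CoefIn 𝒢 (mulBF σA z Φ γ)
  | GB.pow 0 => by simp only [mulBF]; exact hΦ
  | GB.pow (k + 1) => by simp only [mulBF]; exact coefIn_mulTF 𝒢 hGσ (coefIn_mulBF hok hΦ (GB.pow k))
  | GB.invPow 0 => by simp only [mulBF]; exact coefIn_mulCF 𝒢 hGσ hGinv hGdiff z hok hΦ
  | GB.invPow (k + 1) => by
    simp only [mulBF]; exact coefIn_mulCF 𝒢 hGσ hGinv hGdiff z (mulBF_ok z hok _) (coefIn_mulBF hok hΦ (GB.invPow k))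
  | GB.invLet a 0 => by simp only [mulBF]; exact coefIn_mulCF 𝒢 hGσ hGinv hGdiff a hok hΦ
  | GB.invLet a (k + 1) => by
    simp only [mulBF]; exact coefIn_mulCF 𝒢 hGσ hGinv hGdiff a (mulBF_ok z hok _) (coefIn_mulBF hok hΦ (GB.invLet a k))

end ProductsFamily

/-! ### Relabelling invariance of the regularised hyperlogarithms -/

section Relabel

variable {β γ : Type*} [DecidableEq β] [DecidableEq γ]
  {σ : β → ℝ} {zb : β} (hzb : σ zb = 0) (hσb : ∀ c, c ≠ zb → 1 ≤ σ c)
  {ρ : γ → ℝ} {zc : γ} (hzc : ρ zc = 0) (hρc : ∀ c, c ≠ zc → 1 ≤ ρ c)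
  (κ : β → γ) (hκ : ∀ c, ρ (κ c) = σ c)
include hzb hσb hzc hρc hκ

/-- **Relabelling invariance of the regularised hyperlogarithms**: for a value-preserving map of
alphabets `κ` (`ρ ∘ κ = σ`), `L_{κU}(y; ρ) = L_U(y; σ)` on `(0,1)` — by induction on `U`: same ODE,
zero derivative of the difference, and regularised value `δ_{U,∅}` at `0⁺` on both sides
(layer VI). [folklore] -/
theorem hlogSeries_map : ∀ (U : List β) {y : ℝ}, y ∈ Ioo (0 : ℝ) 1 →
    hlogSeries ρ zc y (U.map κ) = hlogSeries σ zb y U := by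
  have hone : HasTaylor (fun _ : ℝ => (1 : ℝ)) (fun i => if i = 0 then 1 else 0) :=
    hasTaylor_of_finite 0 (fun i hi => if_neg (by omega)) (Eventually.of_forall fun a => by simp)
  have hregρ : ∀ W : List γ, HasRegValue (fun y => hlogSeries ρ zc y W) (if W = [] then 1 else 0) := by
    intro W
    have h := hasRegValue_zpow_mul_taylor_mul_hlogSeries hzc hρc hone 0 W
    simp only [le_refl, if_true, neg_zero, Int.toNat_zero, Finset.Nat.antidiagonal_zero,
      Finset.sum_singleton, one_mul, zpow_zero, regCoeff_zero] at h
    exact h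
  have hregσ : ∀ W : List β, HasRegValue (fun y => hlogSeries σ zb y W) (if W = [] then 1 else 0) := by
    intro W
    have h := hasRegValue_zpow_mul_taylor_mul_hlogSeries hzb hσb hone 0 W
    simp only [le_refl, if_true, neg_zero, Int.toNat_zero, Finset.Nat.antidiagonal_zero,
      Finset.sum_singleton, one_mul, zpow_zero, regCoeff_zero] at h
    exact h
  intro U
  induction U with
  | nil => intro y hy; rw [List.map_nil, hlogSeries_nil hzc hρc hy, hlogSeries_nil hzb hσb hy]
  | cons c U IH =>
    intro y hy
    -- the difference has zero derivative on `(0,1)`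
    have hG : ∀ y' ∈ Ioo (0 : ℝ) 1, HasDerivAt (fun y => hlogSeries ρ zc y ((c :: U).map κ) - hlogSeries σ zb y (c :: U)) 0 y' := by
      intro y' hy'
      have h1 := hasDerivAt_hlogSeries_cons hzc hρc (κ c) (U.map κ) hy'
      have h2 := hasDerivAt_hlogSeries_cons hzb hσb c U hy'
      rw [List.map_cons]
      have h := h1.sub h2
      have hp : pden ρ (κ c) y' = pden σ c y' := by simp only [pden, hκ]
      rw [IH hy', hp, sub_self] at h
      exact h
    have hconst : ∀ y₁ ∈ Ioo (0 : ℝ) 1, ∀ y₂ ∈ Ioo (0 : ℝ) 1,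
        hlogSeries ρ zc y₁ ((c :: U).map κ) - hlogSeries σ zb y₁ (c :: U) =
          hlogSeries ρ zc y₂ ((c :: U).map κ) - hlogSeries σ zb y₂ (c :: U) :=
      fun y₁ hy₁ y₂ hy₂ => isOpen_Ioo.is_const_of_deriv_eq_zero (𝕜 := ℝ)
        (f := fun y => hlogSeries ρ zc y ((c :: U).map κ) - hlogSeries σ zb y (c :: U))
        isPreconnected_Ioo (fun y' hy' => (hG y' hy').differentiableAt.differentiableWithinAt)
        (fun y' hy' => (hG y' hy').deriv) hy₁ hy₂
    -- and regularised value `0` at `0⁺`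
    have hr : HasRegValue (fun y => hlogSeries ρ zc y ((c :: U).map κ) - hlogSeries σ zb y (c :: U)) 0 := by
      have h := (hregρ ((c :: U).map κ)).add ((hregσ (c :: U)).smul (-1))
      simp only [List.map_cons, reduceCtorEq, if_false, mul_zero, add_zero] at h
      exact h.congr (Eventually.of_forall fun y => by rw [List.map_cons]; ring)
    have htend : Tendsto (fun y' => hlogSeries ρ zc y' ((c :: U).map κ) - hlogSeries σ zb y' (c :: U)) (𝓝[>] 0)
        (𝓝 (hlogSeries ρ zc y ((c :: U).map κ) - hlogSeries σ zb y (c :: U))) := by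
      refine tendsto_const_nhds.congr' ?_
      filter_upwards [Ioo_mem_nhdsGT (zero_lt_one' ℝ)] with y' hy'
      exact hconst y hy y' hy'
    have := hr.eq_of_tendsto htend
    linarith

end Relabel

/-! ### The universal expansion of Theorem T4 -/

section UniversalT4

open Let

variable {M : Type*} [Fintype M] [DecidableEq M]

omit [Fintype M] in
/-- Length bound on the support of an expansion. [folklore] -/
def SuppLen (n : ℕ) (E : List (Option M) →₀ ℝ) : Prop := ∀ U ∈ E.support, U.length ≤ n

omit [Fintype M] [DecidableEq M] in
/-- `0` has every length bound. [folklore] -/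
theorem suppLen_zero (n : ℕ) : SuppLen n (0 : List (Option M) →₀ ℝ) := fun U hU => by simp at hU

omit [Fintype M] in
/-- Length bounds are preserved by sums. [folklore] -/
theorem SuppLen.add {n : ℕ} {E F : List (Option M) →₀ ℝ} (hE : SuppLen n E) (hF : SuppLen n F) : SuppLen n (E + F) :=
  fun U hU => by
    rcases Finset.mem_union.1 (Finsupp.support_add hU) with h | h
    · exact hE U h
    · exact hF U h

omit [Fintype M] [DecidableEq M] in
/-- Length bounds are monotone. [folklore] -/
theorem SuppLen.mono {m n : ℕ} (h : m ≤ n) {E : List (Option M) →₀ ℝ} (hE : SuppLen m E) : SuppLen n E :=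
  fun U hU => (hE U hU).trans h

omit [Fintype M] [DecidableEq M] in
/-- A single has the length bound of its word. [folklore] -/
theorem suppLen_single {n : ℕ} {U : List (Option M)} (hU : U.length ≤ n) (a : ℝ) : SuppLen n (Finsupp.single U a) :=
  fun V hV => by rw [Finset.mem_singleton.1 (Finsupp.support_single_subset hV)]; exact hU

omit [Fintype M] [DecidableEq M] in
/-- Length bounds are preserved by finite sums. [folklore] -/
theorem suppLen_finset_sum {ι : Type*} {n : ℕ} (s : Finset ι) {E : ι → List (Option M) →₀ ℝ}
    (h : ∀ i ∈ s, SuppLen n (E i)) : SuppLen n (∑ i ∈ s, E i) := by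
  classical
  intro U hU
  obtain ⟨i, hi, hiU⟩ := Finset.mem_biUnion.1 (Finsupp.support_finsetSum hU)
  exact h i hi U hiU

omit [Fintype M] [DecidableEq M] in
/-- The primitive expansion raises the length bound by one. [folklore] -/
theorem suppLen_primE {n : ℕ} (f : Option M →₀ ℝ) {E : List (Option M) →₀ ℝ} (hE : SuppLen n E) :
    SuppLen (n + 1) (primE f E) := by
  classical
  unfold primE
  simp only [Finsupp.sum]
  refine suppLen_finset_sum _ fun ℓ _ => suppLen_finset_sum _ fun U hU => suppLen_single ?_ _
  simpa using hE U hU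

omit [Fintype M] in
/-- The inner deletion expansions respect the length bound. [folklore] -/
theorem suppLen_DsumE {n : ℕ} (X : List (Let M) → (List (Option M) →₀ ℝ))
    (hX : ∀ w : List (Let M), w.length < n → SuppLen w.length (X w)) :
    ∀ (u pre : List (Let M)) (c₀ : Let M), pre.length + 1 + u.length = n →
    SuppLen n (DsumE X (pre ++ [c₀]) c₀ u) := by
  intro u
  induction u with
  | nil => intro pre c₀ _; exact suppLen_zero n
  | cons a u IH =>
    intro pre c₀ hlen
    simp only [DsumE]
    refine SuppLen.add ?_ (by simpa using IH (pre ++ [c₀]) a (by simp at hlen ⊢; omega))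
    have hlt : (pre ++ [c₀] ++ u).length < n := by simp at hlen ⊢; omega
    have hlen' : (pre ++ [c₀] ++ u).length + 1 = n := by simp at hlen ⊢; omega
    rw [← hlen']
    exact suppLen_primE _ (hX _ hlt)

omit [Fintype M] in
/-- The top deletion expansion respects the length bound. [folklore] -/
theorem suppLen_DtopE {n : ℕ} (X : List (Let M) → (List (Option M) →₀ ℝ))
    (hX : ∀ w : List (Let M), w.length < n → SuppLen w.length (X w)) {v : List (Let M)} (hlen : v.length = n) :
    SuppLen n (DtopE X v) := by
  cases v with
  | nil => exact suppLen_zero n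
  | cons c u =>
    simp only [DtopE]
    have hlen0 : ([] : List (Let M)).length + 1 + u.length = n := by
      simp only [List.length_cons] at hlen; simp only [List.length_nil]; omega
    refine SuppLen.add ?_ (by simpa using suppLen_DsumE X hX u [] c hlen0)
    have hlt : u.length < n := by simp at hlen; omega
    have hlen' : u.length + 1 = n := by simpa using hlen
    rw [← hlen']
    exact suppLen_primE _ (hX u hlt)

/-- **Theorem T4 with coefficients, uniformly in the parameters**: the expansions `X w` of layer XII
do not depend on `π` (the pairing table is integral, the constants are `0` or `ζ(w)`), and their
words are not longer than `w`. [cite: BrownENS2009, §5.3, §6.3, Thm 6.25 (analogue)] -/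
theorem exists_universal_expansion : ∀ n : ℕ, ∃ X : List (Let M) → (List (Option M) →₀ ℝ),
    ∀ w : List (Let M), w.length ≤ n →
      (∀ {π : M → ℝ}, (∀ c, 0 < π c ∧ π c ≤ 1) → Function.Injective π →
        IsDReg w → ∀ y ∈ Ioo (0 : ℝ) 1, hlogAt1 (σf π y) w = evalE π (X w) y) ∧ (¬IsDReg w → X w = 0) ∧
      GoodE w.length (X w) ∧ SuppLen w.length (X w) := by
  classical
  intro n
  induction n with
  | zero =>
    refine ⟨fun w => if w = [] then Finsupp.single [] 1 else 0, fun w hw => ?_⟩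
    have hw0 : w = [] := List.length_eq_zero_iff.mp (Nat.le_zero.1 hw)
    subst hw0
    refine ⟨fun {π} hπ _ _ y hy => ?_, fun h => absurd isDReg_nil h, ?_, ?_⟩
    · simp only [if_true, evalE_single]
      rw [hlogSeries_nil (σ := τf π) rfl (τf_adm hπ) hy, mul_one, hlogAt1_nil (σf_adm hπ hy)]
    · simp only [if_true]
      exact goodE_single _ (isRat_one.mem_iSup _)
    · simp only [if_true]
      exact suppLen_single (by simp) _
  | succ n IH =>
    obtain ⟨X, hX⟩ := IH
    refine ⟨fun w => if w.length ≤ n then X w else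
      if IsDReg w then Finsupp.single [] (Kconst w) + DtopE X w else 0, fun w hw => ?_⟩
    by_cases hwn : w.length ≤ n
    · simp only [hwn, if_true]; exact hX w hwn
    · have hwlen : w.length = n + 1 := by omega
      simp only [hwn, if_false]
      have hXg : ∀ w' : List (Let M), w'.length < n + 1 → GoodE w'.length (X w') :=
        fun w' hw' => (hX w' (by omega)).2.2.1
      have hXs : ∀ w' : List (Let M), w'.length < n + 1 → SuppLen w'.length (X w') :=
        fun w' hw' => (hX w' (by omega)).2.2.2
      refine ⟨fun {π} hπ hπi hdr y hy => ?_, fun hdr => by rw [if_neg hdr], ?_, ?_⟩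
      · have hX' : ∀ w' : List (Let M), w'.length < n + 1 →
            (IsDReg w' → ∀ y ∈ Ioo (0 : ℝ) 1, hlogAt1 (σf π y) w' = evalE π (X w') y) ∧ (¬IsDReg w' → X w' = 0) :=
          fun w' hw' => ⟨(hX w' (by omega)).1 hπ hπi, (hX w' (by omega)).2.1⟩
        rw [if_pos hdr, evalE_add, evalE_single, hlogSeries_nil (σ := τf π) rfl (τf_adm hπ) hy, mul_one]
        have hG : ∀ y' ∈ Ioo (0 : ℝ) 1, HasDerivAt (fun y => hlogAt1 (σf π y) w - evalE π (DtopE X w) y) 0 y' := by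
          intro y' hy'
          have h1 := hasDerivAt_hlogAt1_σf hπ hπi hdr hy'
          have h2 := hasDerivAt_evalE_DtopE hπ hπi X hX' hdr (le_of_eq hwlen) hy'
          have h := h1.sub h2
          rwa [sub_self] at h
        have hconst : ∀ y₁ ∈ Ioo (0 : ℝ) 1, ∀ y₂ ∈ Ioo (0 : ℝ) 1,
            hlogAt1 (σf π y₁) w - evalE π (DtopE X w) y₁ = hlogAt1 (σf π y₂) w - evalE π (DtopE X w) y₂ :=
          fun y₁ hy₁ y₂ hy₂ => isOpen_Ioo.is_const_of_deriv_eq_zero (𝕜 := ℝ)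
            (f := fun y => hlogAt1 (σf π y) w - evalE π (DtopE X w) y)
            isPreconnected_Ioo (fun y' hy' => (hG y' hy').differentiableAt.differentiableWithinAt)
            (fun y' hy' => (hG y' hy').deriv) hy₁ hy₂
        have hreg : HasRegValue (fun y => hlogAt1 (σf π y) w - evalE π (DtopE X w) y)
            (Kconst w + (-1) * DtopE X w []) :=
          ((hasRegValue_hlogAt1_σf hπ hdr).add ((hasRegValue_evalE hπ (DtopE X w)).smul (-1))).congr
            (Eventually.of_forall fun y => by ring)
        have htend : Tendsto (fun y' => hlogAt1 (σf π y') w - evalE π (DtopE X w) y') (𝓝[>] 0)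
            (𝓝 (hlogAt1 (σf π y) w - evalE π (DtopE X w) y)) := by
          refine tendsto_const_nhds.congr' ?_
          filter_upwards [Ioo_mem_nhdsGT (zero_lt_one' ℝ)] with y' hy'
          exact hconst y hy y' hy'
        have := hreg.eq_of_tendsto htend
        rw [DtopE_nil_entry, mul_zero, add_zero] at this
        linarith
      · rw [hwlen]
        split_ifs with hdr
        · refine (goodE_single [] ?_).add (goodE_DtopE X hXg hwlen)
          simpa [hwlen] using kconst_mem hdr
        · exact goodE_zero _
      · rw [hwlen]
        split_ifs with hdr
        · exact (suppLen_single (by simp) _).add (suppLen_DtopE X hXs hwlen)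
        · exact suppLen_zero _

/-- **The universal expansion**, chosen once and for all. [folklore] -/
def uexp (v : List (Let M)) : List (Option M) →₀ ℝ :=
  Classical.choose (exists_universal_expansion (M := M) v.length) v

/-- The universal expansion evaluates to `L_v(1; σ_y)` for every admissible `π`. [folklore] -/
theorem hlogAt1_eq_evalE_uexp {π : M → ℝ} (hπ : ∀ c, 0 < π c ∧ π c ≤ 1) (hπi : Function.Injective π)
    {v : List (Let M)} (hv : IsDReg v) {y : ℝ} (hy : y ∈ Ioo (0 : ℝ) 1) :
    hlogAt1 (σf π y) v = evalE π (uexp v) y :=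
  (Classical.choose_spec (exists_universal_expansion (M := M) v.length) v le_rfl).1 hπ hπi hv y hy

/-- The universal expansion is good. [folklore] -/
theorem goodE_uexp (v : List (Let M)) : GoodE v.length (uexp v) :=
  (Classical.choose_spec (exists_universal_expansion (M := M) v.length) v le_rfl).2.2.1

/-- The words of the universal expansion of `v` are not longer than `v`. [folklore] -/
theorem suppLen_uexp (v : List (Let M)) : SuppLen v.length (uexp v) :=
  (Classical.choose_spec (exists_universal_expansion (M := M) v.length) v le_rfl).2.2.2

end UniversalT4

/-! ### The levels of the cube: alphabets, coordinates, the algebras of coefficient functions -/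

section Levels

open Let

/-- The parameter space: sequences in the open unit cube (only finitely many coordinates matter at
each level). [folklore] -/
def Dcube : Type := {x : ℕ → ℝ // ∀ k, x k ∈ Ioo (0 : ℝ) 1}

namespace Dcube

/-- The coordinates. [folklore] -/
def c (r : Dcube) (k : ℕ) : ℝ := r.1 k

/-- The coordinates lie in `(0,1)`. [folklore] -/
theorem c_mem (r : Dcube) (k : ℕ) : r.c k ∈ Ioo (0 : ℝ) 1 := r.2 k

/-- The coordinates are positive. [folklore] -/
theorem c_pos (r : Dcube) (k : ℕ) : 0 < r.c k := (r.2 k).1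

/-- The coordinates are `< 1`. [folklore] -/
theorem c_lt_one (r : Dcube) (k : ℕ) : r.c k < 1 := (r.2 k).2

/-- The coordinates are nonzero. [folklore] -/
theorem c_ne_zero (r : Dcube) (k : ℕ) : r.c k ≠ 0 := (r.c_pos k).ne'

/-- Products of coordinates over an interval of indices. [folklore] -/
def pr (r : Dcube) (a b : ℕ) : ℝ := ∏ k ∈ Finset.Ico a b, r.c k

/-- Products of coordinates are positive. [folklore] -/
theorem pr_pos (r : Dcube) (a b : ℕ) : 0 < r.pr a b := Finset.prod_pos fun k _ => r.c_pos k

/-- Products of coordinates are `≤ 1`. [folklore] -/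
theorem pr_le_one (r : Dcube) (a b : ℕ) : r.pr a b ≤ 1 :=
  Finset.prod_le_one (fun k _ => (r.c_pos k).le) fun k _ => (r.c_lt_one k).le

/-- The empty product. [folklore] -/
theorem pr_self (r : Dcube) (a : ℕ) : r.pr a a = 1 := by simp [pr]

/-- Adding one factor at the top. [folklore] -/
theorem pr_succ (r : Dcube) {a b : ℕ} (hab : a ≤ b) : r.pr a (b + 1) = r.pr a b * r.c b := by
  simp [pr, Finset.prod_Ico_succ_top hab]

/-- Nonempty products of coordinates are `< 1`. [folklore] -/
theorem pr_lt_one (r : Dcube) {a b : ℕ} (hab : a < b) : r.pr a b < 1 := by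
  obtain ⟨b, rfl⟩ := Nat.exists_eq_add_of_lt hab
  rw [show a + b + 1 = (a + b) + 1 from rfl, r.pr_succ (Nat.le_add_right a b)]
  calc r.pr a (a + b) * r.c (a + b) < r.pr a (a + b) * 1 :=
        mul_lt_mul_of_pos_left (r.c_lt_one _) (r.pr_pos _ _)
    _ ≤ 1 := by rw [mul_one]; exact r.pr_le_one _ _

/-- Splitting a product of coordinates. [folklore] -/
theorem pr_split (r : Dcube) {a b d : ℕ} (hab : a ≤ b) (hbd : b ≤ d) : r.pr a d = r.pr a b * r.pr b d := by
  simp only [pr]; rw [← Finset.prod_Ico_consecutive _ hab hbd]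

end Dcube

/-- **The alphabet of level `n`** (the letters seen by the coordinate `x_n`, functions of the lower
coordinates): `z ↦ 0`, `o ↦ 1`, `mv a ↦ 1/(x_a x_{a+1} ⋯ x_{n-1})`. [folklore] -/
def σL (n : ℕ) : Let (Fin n) → Dcube → ℝ
  | z => 0
  | o => 1
  | mv a => fun r => 1 / r.pr a n

/-- The `π`-data of level `n+1` (for the cubical family of layer XII with `y = x_n`):
`π_a = x_a ⋯ x_{n-1}`. [folklore] -/
def πL (n : ℕ) (r : Dcube) : Fin (n + 1) → ℝ := fun a => r.pr a n

/-- The `π`-data lie in `(0,1]`. [folklore] -/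
theorem πL_hyp (n : ℕ) (r : Dcube) : ∀ a, 0 < πL n r a ∧ πL n r a ≤ 1 :=
  fun _ => ⟨r.pr_pos _ _, r.pr_le_one _ _⟩

/-- The `π`-data are injective (strictly monotone in the index). [folklore] -/
theorem πL_injective (n : ℕ) (r : Dcube) : Function.Injective (πL n r) := by
  intro a a' h
  by_contra hne
  rcases lt_or_gt_of_ne hne with hlt | hlt
  · have ha' : (a' : ℕ) ≤ n := Nat.lt_succ_iff.mp a'.isLt
    have : πL n r a = r.pr a a' * πL n r a' := r.pr_split (le_of_lt (Fin.lt_def.mp hlt)) ha'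
    rw [h] at this
    have hp := r.pr_lt_one (Fin.lt_def.mp hlt)
    have hpos := (πL_hyp n r a').1
    nlinarith
  · have ha : (a : ℕ) ≤ n := Nat.lt_succ_iff.mp a.isLt
    have : πL n r a' = r.pr a' a * πL n r a := r.pr_split (le_of_lt (Fin.lt_def.mp hlt)) ha
    rw [← h] at this
    have hp := r.pr_lt_one (Fin.lt_def.mp hlt)
    have hpos := (πL_hyp n r a').1
    nlinarith

/-- **The alphabet of level `n+1` at a parameter is the cubical family of layer XII** at `y = x_n`:
`σ_{n+1}(r) = σf (πL n r) (x_n)`. [folklore] -/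
theorem σat_σL_succ (n : ℕ) (r : Dcube) : σat (σL (n + 1)) r = σf (πL n r) (r.c n) := by
  funext a
  cases a with
  | z => rfl
  | o => rfl
  | mv a =>
    simp only [σat_apply, σL, σf, πL]
    rw [r.pr_succ (Nat.lt_succ_iff.mp a.isLt), mul_comm]

/-- The relabelling of the level-`n+1` expansion letters into the alphabet of level `n`:
`none ↦ z`, `some a ↦ mv a` (`a < n`), `some n ↦ o`. [folklore] -/
def ιL (n : ℕ) : Option (Fin (n + 1)) → Let (Fin n)
  | none => z
  | some a => if h : (a : ℕ) < n then mv ⟨a, h⟩ else o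

/-- The relabelling preserves the values: `τf (πL n r) ℓ = σ_n(r) (ιL n ℓ)`. [folklore] -/
theorem σL_ιL (n : ℕ) (r : Dcube) : ∀ ℓ : Option (Fin (n + 1)), σat (σL n) r (ιL n ℓ) = τf (πL n r) ℓ
  | none => rfl
  | some a => by
    simp only [ιL, τf, πL]
    by_cases h : (a : ℕ) < n
    · rw [dif_pos h]; rfl
    · rw [dif_neg h]
      have ha : (a : ℕ) = n := le_antisymm (Nat.lt_succ_iff.mp a.isLt) (not_lt.mp h)
      simp only [σat_apply, σL]
      rw [ha, Dcube.pr_self, div_one]; rfl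

/-- The level alphabets are admissible: `σ_n z = 0`. [folklore] -/
theorem σL_z (n : ℕ) (r : Dcube) : σat (σL n) r z = 0 := rfl

/-- The level alphabets are admissible: the other letters are `≥ 1`. [folklore] -/
theorem σL_adm (n : ℕ) (r : Dcube) : ∀ a : Let (Fin n), a ≠ z → 1 ≤ σat (σL n) r a
  | z, h => (h rfl).elim
  | o, _ => le_rfl
  | mv a, _ => by
    simp only [σat_apply, σL]
    rw [le_div_iff₀ (r.pr_pos _ _), one_mul]; exact r.pr_le_one _ _

/-- `σ_n o = 1`. [folklore] -/
theorem σL_o (n : ℕ) (r : Dcube) : σat (σL n) r o = 1 := rfl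

/-- The moving letters are `> 1`. [folklore] -/
theorem one_lt_σL_mv (n : ℕ) (r : Dcube) (a : Fin n) : 1 < σat (σL n) r (mv a) := by
  simp only [σat_apply, σL]
  rw [lt_div_iff₀ (r.pr_pos _ _), one_mul]; exact r.pr_lt_one a.isLt

/-- Only `o` is at `1`. [folklore] -/
theorem σL_ne_one (n : ℕ) (r : Dcube) : ∀ a : Let (Fin n), a ≠ o → σat (σL n) r a ≠ 1
  | z, _ => by simp [σat_apply, σL]
  | o, h => (h rfl).elim
  | mv a, _ => (one_lt_σL_mv n r a).ne'

/-- Uniform zero pattern of the level alphabets. [folklore] -/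
theorem σL_hZu (n : ℕ) : ∀ c : Let (Fin n), σL n c = 0 ∨ ∀ r, σL n c r ≠ 0
  | z => Or.inl rfl
  | o => Or.inr fun _ => one_ne_zero
  | mv a => Or.inr fun r => (zero_lt_one.trans (one_lt_σL_mv n r a)).ne'

/-- Uniform coincidence pattern of the level alphabets. [folklore] -/
theorem σL_hEu (n : ℕ) : ∀ a c : Let (Fin n), σL n c = σL n a ∨ ∀ r, σL n c r ≠ σL n a r := by
  intro a c
  by_cases hac : c = a
  · exact Or.inl (by rw [hac])
  · refine Or.inr fun r h => hac ?_
    -- injectivity of the values at `r`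
    have hinj : ∀ b b' : Let (Fin n), σat (σL n) r b = σat (σL n) r b' → b = b' := by
      intro b b' hb
      cases b with
      | z =>
        cases b' with
        | z => rfl
        | o => exact absurd hb (by simp [σat_apply, σL])
        | mv a' => exact absurd hb (by rw [σL_z]; exact (zero_lt_one.trans (one_lt_σL_mv n r a')).ne)
      | o =>
        cases b' with
        | z => exact absurd hb (by simp [σat_apply, σL])
        | o => rfl
        | mv a' => exact absurd hb (by rw [σL_o]; exact (one_lt_σL_mv n r a').ne)
      | mv b =>
        cases b' with
        | z => exact absurd hb.symm (by rw [σL_z]; exact (zero_lt_one.trans (one_lt_σL_mv n r b)).ne)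
        | o => exact absurd hb.symm (by rw [σL_o]; exact (one_lt_σL_mv n r b).ne)
        | mv b' =>
          -- `1/pr b n = 1/pr b' n` with both products in `(0,1]`
          simp only [σat_apply, σL] at hb
          have h1 := r.pr_pos b n
          have h2 := r.pr_pos b' n
          rw [div_eq_div_iff h1.ne' h2.ne', one_mul, one_mul] at hb
          -- the map `a ↦ pr a n` is injective on `Fin n` (strictly increasing)
          by_contra hne
          have hne' : b ≠ b' := fun h => hne (by rw [h])
          rcases lt_or_gt_of_ne hne' with hlt | hlt
          · have := r.pr_split (le_of_lt (Fin.lt_def.mp hlt)) (le_of_lt b'.isLt)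
            rw [← hb] at this
            have hp := r.pr_lt_one (Fin.lt_def.mp hlt)
            nlinarith
          · have := r.pr_split (le_of_lt (Fin.lt_def.mp hlt)) (le_of_lt b.isLt)
            rw [hb] at this
            have hp := r.pr_lt_one (Fin.lt_def.mp hlt)
            nlinarith
    exact hinj c a h

/-- The atoms: the basis functions of level `k` in the coordinate `x_k`. [folklore] -/
def atom (k : ℕ) (β : GB (Let (Fin k))) : Dcube → ℝ := fun r => bvalG (σat (σL k) r) β (r.c k)

/-- **The algebra `𝒢_n` of coefficient functions of level `n`**: generated over `ℚ` by the admissible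
atoms of all levels `< n`. [folklore] -/
def 𝒢L (n : ℕ) : Subalgebra ℚ (Dcube → ℝ) :=
  Algebra.adjoin ℚ {f | ∃ k, k < n ∧ ∃ β : GB (Let (Fin k)), GB.ok (σL k) β ∧ f = atom k β}

/-- Admissible atoms of lower levels are in `𝒢_n`. [folklore] -/
theorem atom_mem {n k : ℕ} (hk : k < n) {β : GB (Let (Fin k))} (hβ : GB.ok (σL k) β) : atom k β ∈ 𝒢L n :=
  Algebra.subset_adjoin ⟨k, hk, β, hβ, rfl⟩

/-- The level algebras increase with the level. [folklore] -/
theorem 𝒢L_mono {m n : ℕ} (h : m ≤ n) : 𝒢L m ≤ 𝒢L n :=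
  Algebra.adjoin_mono fun _ ⟨k, hk, β, hβ, hf⟩ => ⟨k, lt_of_lt_of_le hk h, β, hβ, hf⟩

/-- The coordinate functions `x_k` and their inverses are atoms. [folklore] -/
theorem coord_mem {n k : ℕ} (hk : k < n) : (fun r : Dcube => r.c k) ∈ 𝒢L n := by
  have h := atom_mem hk (β := GB.pow 1) trivial
  have : atom k (GB.pow 1) = fun r : Dcube => r.c k := by funext r; simp [atom, bvalG]
  rwa [this] at h

/-- The inverse coordinate functions are atoms. [folklore] -/
theorem coord_inv_mem {n k : ℕ} (hk : k < n) : (fun r : Dcube => (r.c k)⁻¹) ∈ 𝒢L n := by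
  have h := atom_mem hk (β := GB.invPow 0) trivial
  have : atom k (GB.invPow 0) = fun r : Dcube => (r.c k)⁻¹ := by funext r; simp [atom, bvalG]
  rwa [this] at h

/-- Products of coordinates and their inverses are in `𝒢_n`. [folklore] -/
theorem pr_mem {n a b : ℕ} (hb : b ≤ n) : (fun r : Dcube => r.pr a b) ∈ 𝒢L n := by
  have : (fun r : Dcube => r.pr a b) = ∏ k ∈ Finset.Ico a b, fun r : Dcube => r.c k := by
    funext r; simp [Dcube.pr, Finset.prod_apply]
  rw [this]
  exact Subalgebra.prod_mem _ fun k hk => coord_mem (lt_of_lt_of_le (Finset.mem_Ico.1 hk).2 hb)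

/-- Inverses of products of coordinates are in `𝒢_n`. [folklore] -/
theorem pr_inv_mem {n a b : ℕ} (hb : b ≤ n) : (fun r : Dcube => (r.pr a b)⁻¹) ∈ 𝒢L n := by
  have : (fun r : Dcube => (r.pr a b)⁻¹) = ∏ k ∈ Finset.Ico a b, fun r : Dcube => (r.c k)⁻¹ := by
    funext r; simp [Dcube.pr, Finset.prod_apply, Finset.prod_inv_distrib]
  rw [this]
  exact Subalgebra.prod_mem _ fun k hk => coord_inv_mem (lt_of_lt_of_le (Finset.mem_Ico.1 hk).2 hb)

end Levels

/-! ### The generators of Theorem F₁ are in the level algebras -/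

section Gens

open Let

/-- `1/(1 - x_a ⋯ x_{n-1}) ∈ 𝒢_n` for `a < n`: it is the letter `1/(x_a⋯x_{n-2})` of level `n-1`
times the atom `1/(1/(x_a⋯x_{n-2}) - x_{n-1})`. [folklore] -/
theorem inv_one_sub_pr_mem {n a : ℕ} (ha : a < n) : (fun r : Dcube => (1 - r.pr a n)⁻¹) ∈ 𝒢L n := by
  obtain ⟨m, rfl⟩ := Nat.exists_eq_add_of_lt ha
  -- level `m' := a + m`, coordinate `x_{a+m}`
  set m' := a + m with hm'
  have ham : a ≤ m' := Nat.le_add_right a m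
  -- the letter of level `m'` with value `1/pr a m'`
  set ℓ : Let (Fin m') := if h : a < m' then mv ⟨a, h⟩ else o with hℓ
  have hℓval : ∀ r : Dcube, σat (σL m') r ℓ = 1 / r.pr a m' := by
    intro r
    by_cases h : a < m'
    · simp only [hℓ, dif_pos h, σat_apply, σL]
    · have : a = m' := le_antisymm ham (not_lt.mp h)
      simp only [hℓ, dif_neg h, σat_apply, σL]
      rw [← this, Dcube.pr_self, div_one]; rfl
  have hℓok : GB.ok (σL m') (GB.invLet ℓ 0) := by
    show σL m' ℓ ≠ 0
    intro h0
    have := congrFun h0 (Classical.choice ⟨⟨fun _ => 1 / 2, fun _ => by norm_num⟩⟩ : Dcube)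
    rcases σL_hZu m' ℓ with h | h
    · by_cases ha' : a < m'
      · simp only [hℓ, dif_pos ha'] at h; exact absurd h (by
          intro h'; have := congrFun h' (Classical.choice ⟨⟨fun _ => 1 / 2, fun _ => by norm_num⟩⟩ : Dcube)
          exact (σL_hZu m' (mv ⟨a, ha'⟩)).elim (fun h'' => by
            have r0 : Dcube := Classical.choice ⟨⟨fun _ => 1 / 2, fun _ => by norm_num⟩⟩
            exact absurd (congrFun h'' r0) (zero_lt_one.trans (one_lt_σL_mv m' r0 ⟨a, ha'⟩)).ne') (fun h'' => h'' _ this))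
      · simp only [hℓ, dif_neg ha'] at h; exact one_ne_zero (congrFun h (Classical.choice ⟨⟨fun _ => 1 / 2, fun _ => by norm_num⟩⟩))
    · exact h _ this
  have hfac : (fun r : Dcube => (1 - r.pr a (m' + 1))⁻¹) = (fun r : Dcube => (r.pr a m')⁻¹) * atom m' (GB.invLet ℓ 0) := by
    funext r
    simp only [Pi.mul_apply, atom, bvalG, hℓval r, zero_add, pow_one]
    have hp : r.pr a m' ≠ 0 := (r.pr_pos _ _).ne'
    rw [r.pr_succ ham]
    have h1 : 1 / r.pr a m' - r.c m' ≠ 0 := by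
      have := r.c_lt_one m'
      have hle := r.pr_le_one a m'
      have hpos := r.pr_pos a m'
      have : 1 ≤ 1 / r.pr a m' := by rw [le_div_iff₀ hpos]; linarith
      linarith
    have h2 : 1 - r.pr a m' * r.c m' ≠ 0 := by
      intro h; apply h1; field_simp; linarith
    rw [← mul_inv, mul_sub, mul_one_div_cancel hp]
  rw [hfac]
  exact Subalgebra.mul_mem _ (pr_inv_mem (Nat.le_succ _)) (atom_mem (Nat.lt_succ_self _) hℓok)

/-- The letters of level `n` are in `𝒢_n`. [folklore] -/
theorem σL_mem (n : ℕ) : ∀ a : Let (Fin n), σL n a ∈ 𝒢L n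
  | z => Subalgebra.zero_mem (𝒢L n)
  | o => Subalgebra.one_mem (𝒢L n)
  | mv a => by
    have : σL n (mv a) = fun r : Dcube => (r.pr a n)⁻¹ := by funext r; simp [σL]
    rw [this]; exact pr_inv_mem le_rfl

/-- The inverses of the nonzero letters of level `n` are in `𝒢_n`. [folklore] -/
theorem σL_inv_mem (n : ℕ) : ∀ a : Let (Fin n), σL n a ≠ 0 → (σL n a)⁻¹ ∈ 𝒢L n
  | z, h => (h rfl).elim
  | o, _ => by
    have : (σL n o)⁻¹ = (1 : Dcube → ℝ) := by funext r; simp [σL]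
    rw [this]; exact Subalgebra.one_mem _
  | mv a, _ => by
    have : (σL n (mv a))⁻¹ = fun r : Dcube => r.pr a n := by funext r; simp [σL]
    rw [this]; exact pr_mem le_rfl

/-- The inverse differences of distinct letters of level `n` are in `𝒢_n`. [folklore] -/
theorem σL_diff_inv_mem (n : ℕ) : ∀ a c : Let (Fin n), σL n c ≠ σL n a → (σL n c - σL n a)⁻¹ ∈ 𝒢L n := by
  -- an auxiliary nonempty parameter to discharge `σ c ≠ σ a` into index inequalities
  have r₀ : Dcube := ⟨fun _ => 1 / 2, fun _ => by norm_num⟩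
  intro a c hca
  cases c with
  | z =>
    cases a with
    | z => exact absurd rfl hca
    | o =>
      have : (σL n z - σL n o)⁻¹ = fun _ : Dcube => ((-1 : ℚ) : ℝ) := by funext r; simp [σL]
      rw [this]; exact const_mem_of_isRat _ (isRat_ratCast _)
    | mv a =>
      have : (σL n z - σL n (mv a))⁻¹ = fun r : Dcube => ((-1 : ℚ) : ℝ) * r.pr a n := by
        funext r; simp [σL]
      rw [this]; exact ratCast_mul_mem _ _ (pr_mem le_rfl)
  | o =>
    cases a with
    | z =>
      have : (σL n o - σL n z)⁻¹ = (1 : Dcube → ℝ) := by funext r; simp [σL]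
      rw [this]; exact Subalgebra.one_mem _
    | o => exact absurd rfl hca
    | mv a =>
      -- `(1 - 1/P)⁻¹ = -P (1-P)⁻¹`
      have : (σL n o - σL n (mv a))⁻¹ = fun r : Dcube => ((-1 : ℚ) : ℝ) * (r.pr a n * (1 - r.pr a n)⁻¹) := by
        funext r
        have hp : r.pr a n ≠ 0 := (r.pr_pos _ _).ne'
        have h1 : 1 - r.pr a n ≠ 0 := by have := r.pr_lt_one a.isLt; linarith
        simp only [σL, Pi.sub_apply, Pi.inv_apply, Pi.one_apply]
        rw [show (1 : ℝ) - 1 / r.pr a n = -((1 - r.pr a n) / r.pr a n) by field_simp; ring, inv_neg, inv_div]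
        push_cast
        field_simp
      rw [this]
      exact ratCast_mul_mem _ _ (Subalgebra.mul_mem _ (pr_mem le_rfl) (inv_one_sub_pr_mem a.isLt))
  | mv c =>
    cases a with
    | z =>
      have : (σL n (mv c) - σL n z)⁻¹ = fun r : Dcube => r.pr c n := by funext r; simp [σL]
      rw [this]; exact pr_mem le_rfl
    | o =>
      have : (σL n (mv c) - σL n o)⁻¹ = fun r : Dcube => r.pr c n * (1 - r.pr c n)⁻¹ := by
        funext r
        have hp : r.pr c n ≠ 0 := (r.pr_pos _ _).ne'
        have h1 : 1 - r.pr c n ≠ 0 := by have := r.pr_lt_one c.isLt; linarith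
        simp only [σL, Pi.sub_apply, Pi.inv_apply, Pi.one_apply]
        field_simp
      rw [this]
      exact Subalgebra.mul_mem _ (pr_mem le_rfl) (inv_one_sub_pr_mem c.isLt)
    | mv a =>
      have hne : c ≠ a := fun h => hca (by rw [h])
      rcases lt_or_gt_of_ne (Fin.val_injective.ne hne) with hlt | hlt
      · -- `c < a`: `σ_c - σ_a = 1/(Q P_a) - 1/P_a`, `Q = pr c a`; inverse `= P_c (1-Q)⁻¹`
        have : (σL n (mv c) - σL n (mv a))⁻¹ = fun r : Dcube => r.pr c n * (1 - r.pr c a)⁻¹ := by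
          funext r
          have hQ : r.pr c n = r.pr c a * r.pr a n := r.pr_split (le_of_lt hlt) (le_of_lt a.isLt)
          have hp : r.pr a n ≠ 0 := (r.pr_pos _ _).ne'
          have hq : r.pr c a ≠ 0 := (r.pr_pos _ _).ne'
          have h1 : 1 - r.pr c a ≠ 0 := by have := r.pr_lt_one hlt; linarith
          simp only [σL, Pi.sub_apply, Pi.inv_apply]
          rw [hQ]
          rw [show 1 / (r.pr c a * r.pr a n) - 1 / r.pr a n = (1 - r.pr c a) / (r.pr c a * r.pr a n) by
            field_simp, inv_div]
          field_simp
        rw [this]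
        exact Subalgebra.mul_mem _ (pr_mem le_rfl) (𝒢L_mono (le_of_lt a.isLt) (inv_one_sub_pr_mem hlt))
      · -- `a < c`
        have : (σL n (mv c) - σL n (mv a))⁻¹ = fun r : Dcube => ((-1 : ℚ) : ℝ) * (r.pr a n * (1 - r.pr a c)⁻¹) := by
          funext r
          have hQ : r.pr a n = r.pr a c * r.pr c n := r.pr_split (le_of_lt hlt) (le_of_lt c.isLt)
          have hp : r.pr c n ≠ 0 := (r.pr_pos _ _).ne'
          have hq : r.pr a c ≠ 0 := (r.pr_pos _ _).ne'
          have h1 : 1 - r.pr a c ≠ 0 := by have := r.pr_lt_one hlt; linarith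
          simp only [σL, Pi.sub_apply, Pi.inv_apply]
          rw [hQ]
          rw [show 1 / r.pr c n - 1 / (r.pr a c * r.pr c n) = -((1 - r.pr a c) / (r.pr a c * r.pr c n)) by
            field_simp; ring, inv_neg, inv_div]
          push_cast
          field_simp
        rw [this]
        exact ratCast_mul_mem _ _ (Subalgebra.mul_mem _ (pr_mem le_rfl)
          (𝒢L_mono (le_of_lt c.isLt) (inv_one_sub_pr_mem hlt)))

/-- Nonvanishing letters are nonvanishing at every parameter. [folklore] -/
theorem σL_hZ' (n : ℕ) : ∀ a : Let (Fin n), σL n a ≠ 0 → ∀ r, σL n a r ≠ 0 := by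
  intro a ha r
  rcases σL_hZu n a with h | h
  · exact absurd h ha
  · exact h r

/-- Uniform admissibility implies admissibility at every parameter. [folklore] -/
theorem okF_evF {n : ℕ} {Φ : GB (Let (Fin n)) →₀ (Dcube → ℝ)} (hΦ : GBF.ok (σL n) Φ) (r : Dcube) :
    GBF.ok (σat (σL n) r) (evF r Φ) := by
  intro β hβ
  have hβ' : β ∈ Φ.support := by
    rw [Finsupp.mem_support_iff] at hβ ⊢
    intro h; apply hβ; simp [h]
  have h := hΦ β hβ'
  cases β with
  | pow k => trivial
  | invPow k => trivial
  | invLet a k => exact σL_hZ' n a h r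

end Gens

/-! ### Peeling: functions of level `m+1` are combinations of level-`m` basis functions in `x_m` -/

section Peel

open Let

/-- **Peeling.** Every `g ∈ 𝒢_{m+1}` is, as a function of the coordinate `x_m`, a combination of the
basis functions of level `m` with coefficients in `𝒢_m`:
`g(r) = Σ_β Φ_β(r) b_β(x_m; σ_m(r))`. [folklore] -/
theorem peel {m : ℕ} {g : Dcube → ℝ} (hg : g ∈ 𝒢L (m + 1)) :
    ∃ Φ : GB (Let (Fin m)) →₀ (Dcube → ℝ), CoefIn (𝒢L m) Φ ∧ GBF.ok (σL m) Φ ∧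
      ∀ r : Dcube, g r = bevG (σat (σL m) r) (evF r Φ) (r.c m) := by
  classical
  induction hg using Algebra.adjoin_induction with
  | mem x hx =>
    obtain ⟨k, hk, β, hβ, rfl⟩ := hx
    by_cases hkm : k = m
    · subst hkm
      refine ⟨Finsupp.single β 1, coefIn_single _ _ (Subalgebra.one_mem _), fun β' hβ' => ?_, fun r => ?_⟩
      · rw [Finset.mem_singleton.1 (Finsupp.support_single_subset hβ')]; exact hβ
      · rw [evF_single, bevG_single]; simp [atom]
    · have hk' : k < m := by omega
      refine ⟨Finsupp.single (GB.pow 0) (atom k β), coefIn_single _ _ (atom_mem hk' hβ), fun β' hβ' => ?_, fun r => ?_⟩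
      · rw [Finset.mem_singleton.1 (Finsupp.support_single_subset hβ')]; trivial
      · rw [evF_single, bevG_single]; simp [bvalG]
  | algebraMap q =>
    refine ⟨Finsupp.single (GB.pow 0) (algebraMap ℚ (Dcube → ℝ) q), coefIn_single _ _ (Subalgebra.algebraMap_mem _ _),
      fun β' hβ' => ?_, fun r => ?_⟩
    · rw [Finset.mem_singleton.1 (Finsupp.support_single_subset hβ')]; trivial
    · rw [evF_single, bevG_single]; simp [bvalG]
  | add x y hx hy ihx ihy =>
    obtain ⟨Φ₁, hc₁, ho₁, hv₁⟩ := ihx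
    obtain ⟨Φ₂, hc₂, ho₂, hv₂⟩ := ihy
    refine ⟨Φ₁ + Φ₂, hc₁.add _ hc₂, fun β hβ => ?_, fun r => ?_⟩
    · rcases Finset.mem_union.1 (Finsupp.support_add hβ) with h | h
      · exact ho₁ β h
      · exact ho₂ β h
    · rw [map_add, bevG_add, Pi.add_apply, hv₁, hv₂]
  | mul x y hx hy ihx ihy =>
    obtain ⟨Φ₁, hc₁, ho₁, hv₁⟩ := ihx
    obtain ⟨Φ₂, hc₂, ho₂, hv₂⟩ := ihy
    refine ⟨Φ₂.sum fun γ g => g • mulBF (σL m) z Φ₁ γ, ?_, ?_, fun r => ?_⟩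
    · exact coefIn_finsupp_sum _ hc₂ fun γ g hg =>
        (coefIn_mulBF z (𝒢L m) (σL_mem m) (σL_inv_mem m) (σL_diff_inv_mem m) ho₁ hc₁ γ).smul _ hg
    · exact ok_sum_smul Φ₂ _ fun γ _ => mulBF_ok z ho₁ γ
    · rw [Pi.mul_apply, hv₁, hv₂]
      rw [evF_sum_smul r Φ₂ _ _ (evF_mulBF z (σL_hZu m) (σL_hEu m) r Φ₁), bevG_finsupp_sum]
      simp only [bevG_smul]
      have hok := okF_evF ho₁ r
      have h2 : bevG (σat (σL m) r) (evF r Φ₂) (r.c m) =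
          ∑ γ ∈ (evF r Φ₂).support, (evF r Φ₂) γ * bvalG (σat (σL m) r) γ (r.c m) := by
        rw [bevG, Finsupp.sum]
      rw [h2, Finset.mul_sum, Finsupp.sum]
      refine Finset.sum_congr rfl fun γ hγ => ?_
      have hγok : GB.ok (σat (σL m) r) γ := okF_evF ho₂ r γ hγ
      rw [bevG_mulBF (σL_z m r) (σL_adm m r) hok (r.c_mem m) hγok]
      ring

end Peel

/-! ### Weights: the filtered algebra of multiple zeta values and the coefficient modules -/

section Weighted

open Let

/-- `𝒵_{≤a} · 𝒵_{≤b} ⊆ 𝒵_{≤ a+b}` (stuffle product). [folklore] -/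
theorem fil_mul_mem {a b : ℕ} {x y : ℝ} (hx : x ∈ Fil a) (hy : y ∈ Fil b) : x * y ∈ Fil (a + b) := by
  have hle : Fil a * Fil b ≤ Fil (a + b) := by
    simp only [Fil, Submodule.iSup_mul, Submodule.mul_iSup]
    refine iSup₂_le fun w hw => iSup₂_le fun w' hw' => ?_
    refine (Submodule.mul_le.2 fun m hm n hn => mem_mzvSpace_mul_holds hm hn).trans ?_
    exact mzvSpace_le_fil (by omega)
  exact hle (Submodule.mul_mem_mul hx hy)

/-- **The coefficient module of level `n` and weight `k`**: the `ℚ`-span of the `K · g`,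
`K ∈ 𝒵_{≤k}`, `g ∈ 𝒢_n`. [folklore] -/
def Mw (n k : ℕ) : Submodule ℚ (Dcube → ℝ) :=
  Submodule.span ℚ {f | ∃ K, K ∈ Fil k ∧ ∃ g, g ∈ 𝒢L n ∧ f = K • g}

/-- The generators of `M_n^{(k)}`. [folklore] -/
theorem smul_mem_mw {n k : ℕ} {K : ℝ} (hK : K ∈ Fil k) {g : Dcube → ℝ} (hg : g ∈ 𝒢L n) : K • g ∈ Mw n k :=
  Submodule.subset_span ⟨K, hK, g, hg, rfl⟩

/-- Monotonicity of the coefficient modules in the level and the weight. [folklore] -/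
theorem mw_mono {n n' k k' : ℕ} (hn : n ≤ n') (hk : k ≤ k') : Mw n k ≤ Mw n' k' :=
  Submodule.span_mono fun _ ⟨K, hK, g, hg, hf⟩ => ⟨K, fil_mono hk hK, g, 𝒢L_mono hn hg, hf⟩

/-- `𝒢_n ⊆ M_n^{(k)}`. [folklore] -/
theorem mem_mw_of_mem_𝒢L {n k : ℕ} {g : Dcube → ℝ} (hg : g ∈ 𝒢L n) : g ∈ Mw n k := by
  have h := smul_mem_mw (isRat_one.mem_iSup k) hg
  rwa [one_smul] at h

/-- `M_n^{(k)}` is a `𝒢_n`-module. [folklore] -/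
theorem mul_mem_mw {n k : ℕ} {g' : Dcube → ℝ} (hg' : g' ∈ 𝒢L n) {f : Dcube → ℝ} (hf : f ∈ Mw n k) : g' * f ∈ Mw n k := by
  induction hf using Submodule.span_induction with
  | mem x hx =>
    obtain ⟨K, hK, g, hg, rfl⟩ := hx
    have : g' * K • g = K • (g' * g) := by funext r; simp [mul_left_comm]
    rw [this]; exact smul_mem_mw hK (Subalgebra.mul_mem _ hg' hg)
  | zero => rw [mul_zero]; exact Submodule.zero_mem _
  | add x y _ _ hx hy => rw [mul_add]; exact Submodule.add_mem _ hx hy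
  | smul q x _ hx => rw [mul_smul_comm]; exact Submodule.smul_mem _ q hx

/-- Multiplication by multiple zeta values raises the weight. [folklore] -/
theorem fil_smul_mem_mw {n k k' : ℕ} {K' : ℝ} (hK' : K' ∈ Fil k') {f : Dcube → ℝ} (hf : f ∈ Mw n k) :
    K' • f ∈ Mw n (k' + k) := by
  induction hf using Submodule.span_induction with
  | mem x hx =>
    obtain ⟨K, hK, g, hg, rfl⟩ := hx
    rw [smul_smul]; exact smul_mem_mw (fil_mul_mem hK' hK) hg
  | zero => rw [smul_zero]; exact Submodule.zero_mem _
  | add x y _ _ hx hy => rw [smul_add]; exact Submodule.add_mem _ hx hy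
  | smul q x _ hx => rw [smul_comm]; exact Submodule.smul_mem _ q hx

/-- At level `0` the functions are constants in `𝒵_{≤k}`. [folklore] -/
theorem apply_mem_fil_of_mem_mw_zero {k : ℕ} {f : Dcube → ℝ} (hf : f ∈ Mw 0 k) (r : Dcube) : f r ∈ Fil k := by
  induction hf using Submodule.span_induction with
  | mem x hx =>
    obtain ⟨K, hK, g, hg, rfl⟩ := hx
    -- `𝒢_0 = ℚ`
    have hg' : g ∈ (⊥ : Subalgebra ℚ (Dcube → ℝ)) := by
      have : 𝒢L 0 ≤ ⊥ := by
        unfold 𝒢L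
        exact Algebra.adjoin_le fun f ⟨k, hk, _⟩ => absurd hk (Nat.not_lt_zero k)
      exact this hg
    obtain ⟨q, rfl⟩ := Algebra.mem_bot.1 hg'
    simp only [Pi.smul_apply, Algebra.algebraMap_eq_smul_one, Pi.one_apply, smul_eq_mul]
    rw [show K * (q • (1 : ℝ)) = q • K by rw [Rat.smul_one_eq_cast, Rat.smul_def]; ring]
    exact Submodule.smul_mem _ q hK
  | zero => exact Submodule.zero_mem _
  | add x y _ _ hx hy => exact Submodule.add_mem _ hx hy
  | smul q x _ hx => exact Submodule.smul_mem _ q hx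

/-! #### Weighted family elements -/

variable {n : ℕ}

/-- **Weighted family elements of level `n` and total weight `w`**: the coefficient of a word of
length `l` lies in `M_n^{(w-l)}`, and words longer than `w` do not occur. [folklore] -/
def WtIn (n w : ℕ) (F : GH (Let (Fin n)) →₀ (Dcube → ℝ)) : Prop :=
  ∀ x, F x ∈ Mw n (w - x.2.length) ∧ (w < x.2.length → F x = 0)

/-- Words of a weighted family element of weight `w` have length `≤ w`. [folklore] -/
theorem maxLenG_le_of_wtIn {w : ℕ} {F : GH (Let (Fin n)) →₀ (Dcube → ℝ)} (h : WtIn n w F) : maxLenG F ≤ w := by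
  refine Finset.sup_le fun x hx => ?_
  by_contra hlt
  exact (Finsupp.mem_support_iff.1 hx) ((h x).2 (not_le.mp hlt))

/-- **The primitive keeps the weights** (one more letter, same coefficients up to `𝒢_n`). [folklore] -/
theorem wtIn_primG {w : ℕ} {F : GH (Let (Fin n)) →₀ (Dcube → ℝ)} (hok : GH.ok (σL n) F) (h : WtIn n w F) :
    WtIn n (w + 1) (primG (σL n) z F) := by
  classical
  intro y
  have hentry : primG (σL n) z F y = ∑ x ∈ F.support, F x * primBG (σL n) z x.1 x.2 y := by
    unfold primG; simp [Finsupp.sum, Finsupp.finsetSum_apply]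
  have hterm : ∀ x ∈ F.support, F x * primBG (σL n) z x.1 x.2 y ∈ Mw n (w + 1 - y.2.length) ∧
      (w + 1 < y.2.length → F x * primBG (σL n) z x.1 x.2 y = 0) := by
    intro x hx
    by_cases hy : y ∈ (primBG (σL n) z x.1 x.2).support
    · have hlen := length_le_of_mem_support_primBG x.2 x.1 y hy
      have hxw : x.2.length ≤ w := by
        by_contra hlt; exact (Finsupp.mem_support_iff.1 hx) ((h x).2 (not_le.mp hlt))
      refine ⟨?_, fun hgt => by omega⟩
      have hc : primBG (σL n) z x.1 x.2 y ∈ 𝒢L n :=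
        coefIn_primBG z (𝒢L n) (σL_mem n) (σL_inv_mem n) (σL_diff_inv_mem n) x.2 x.1 (hok x hx) y
      have := mul_mem_mw hc (h x).1
      rw [mul_comm] at this
      exact mw_mono le_rfl (by omega) this
    · have h0 : primBG (σL n) z x.1 x.2 y = 0 := Finsupp.notMem_support_iff.1 hy
      rw [h0, mul_zero]
      exact ⟨Submodule.zero_mem _, fun _ => rfl⟩
  rw [hentry]
  exact ⟨Submodule.sum_mem _ fun x hx => (hterm x hx).1, fun hgt => Finset.sum_eq_zero fun x hx => (hterm x hx).2 hgt⟩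

/-- **The output coefficients keep the weights**: `(outA F)_v ∈ M_n^{(w+1-|v|)}`. [folklore] -/
theorem outA_mem_mw {w : ℕ} {F : GH (Let (Fin n)) →₀ (Dcube → ℝ)} (hok : GH.ok (σL n) F) (h : WtIn n w F)
    (v : List (Let (Fin n))) : outA (σL n) z o F v ∈ Mw n (w + 1 - v.length) := by
  classical
  set P := primG (σL n) z F with hP
  have hPw : WtIn n (w + 1) P := wtIn_primG hok h
  have hPok : GH.ok (σL n) P := primG_ok hok
  have hentry : outA (σL n) z o F v = ∑ x ∈ P.support,
      (assocA z o (P x • val1A (σL n) x.1 x.2) v - Finsupp.single [] (P x * fun r => val0 (σat (σL n) r) z x.1 x.2) v) := by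
    unfold outA; rw [← hP]; simp [Finsupp.sum]
  rw [hentry]
  refine Submodule.sum_mem _ fun x hx => Submodule.sub_mem _ ?_ ?_
  · -- the `assocA` part: words `v ∈ reg V`, `V` a suffix of `x.2`
    unfold assocA
    simp only [Finsupp.sum, Finsupp.finsetSum_apply]
    refine Submodule.sum_mem _ fun V hV => Submodule.sum_mem _ fun v' hv' => ?_
    rw [Finsupp.single_apply]
    split_ifs with hvv
    · subst hvv
      have hVsuf : V <:+ x.2 := suffix_of_mem_support_val1A x.1 x.2 V (Finsupp.support_smul hV)
      have hlen : v'.length ≤ x.2.length := by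
        rw [Shuffle.length_eq_of_mem_support_reg z o V hv']; exact hVsuf.length_le
      have hc : (P x • val1A (σL n) x.1 x.2) V ∈ Mw n (w + 1 - x.2.length) := by
        rw [Finsupp.smul_apply, smul_eq_mul, mul_comm]
        exact mul_mem_mw (coefIn_val1A (o := o) (σL_hZu n) (σL_hEu n) rfl (𝒢L n) (σL_diff_inv_mem n) (hPok x hx) x.2 V)
          (hPw x).1
      have : ((Shuffle.reg z o V v' : ℚ) : ℝ) • (P x • val1A (σL n) x.1 x.2) V =
          (Shuffle.reg z o V v' : ℚ) • (P x • val1A (σL n) x.1 x.2) V := by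
        funext r; simp only [Pi.smul_apply, smul_eq_mul, Rat.smul_def]
      rw [this]
      exact Submodule.smul_mem _ _ (mw_mono le_rfl (by omega) hc)
    · exact Submodule.zero_mem _
  · rw [Finsupp.single_apply]
    split_ifs with hv
    · subst hv
      have := mul_mem_mw (val0_mem z (σL_hZu n) (𝒢L n) (σL_inv_mem n) (hPok x hx) x.2) (hPw x).1
      rw [mul_comm] at this
      exact mw_mono le_rfl (by simp) this
    · exact Submodule.zero_mem _

end Weighted

/-! ### Dependence on finitely many coordinates -/

section DepLt

open Let

/-- `f` depends only on the coordinates `< n`. [folklore] -/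
def DepLt (n : ℕ) (f : Dcube → ℝ) : Prop := ∀ r r' : Dcube, (∀ k, k < n → r.c k = r'.c k) → f r = f r'

/-- Monotonicity of the dependence bound. [folklore] -/
theorem DepLt.mono {m n : ℕ} (h : m ≤ n) {f : Dcube → ℝ} (hf : DepLt m f) : DepLt n f :=
  fun r r' hrr' => hf r r' fun k hk => hrr' k (lt_of_lt_of_le hk h)

/-- Products of coordinates below `n` depend on the coordinates `< n`. [folklore] -/
theorem depLt_pr {n a b : ℕ} (hb : b ≤ n) : DepLt n fun r => r.pr a b := by
  intro r r' h
  exact Finset.prod_congr rfl fun k hk => h k (lt_of_lt_of_le (Finset.mem_Ico.1 hk).2 hb)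

/-- The letters of level `n` depend on the coordinates `< n`. [folklore] -/
theorem depLt_σL (n : ℕ) : ∀ a : Let (Fin n), DepLt n (σL n a)
  | z => fun _ _ _ => rfl
  | o => fun _ _ _ => rfl
  | mv a => fun r r' h => by
    have := depLt_pr (a := a) le_rfl r r' h
    simp only [σL] at this ⊢; rw [this]

/-- The alphabet of level `n` at two parameters with the same coordinates `< n`. [folklore] -/
theorem σat_σL_congr {n : ℕ} {r r' : Dcube} (h : ∀ k, k < n → r.c k = r'.c k) : σat (σL n) r = σat (σL n) r' := by
  funext a; exact depLt_σL n a r r' h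

/-- The atoms of level `k` depend on the coordinates `≤ k`. [folklore] -/
theorem depLt_atom (k : ℕ) (β : GB (Let (Fin k))) : DepLt (k + 1) (atom k β) := by
  intro r r' h
  simp only [atom]
  rw [σat_σL_congr (fun j hj => h j (Nat.lt_succ_of_lt hj)), h k (Nat.lt_succ_self k)]

/-- Functions of `𝒢_n` depend on the coordinates `< n`. [folklore] -/
theorem depLt_of_mem_𝒢L {n : ℕ} {g : Dcube → ℝ} (hg : g ∈ 𝒢L n) : DepLt n g := by
  induction hg using Algebra.adjoin_induction with
  | mem x hx =>
    obtain ⟨k, hk, β, -, rfl⟩ := hx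
    exact (depLt_atom k β).mono hk
  | algebraMap q => intro r r' _; rfl
  | add x y _ _ hx hy => intro r r' h; simp only [Pi.add_apply]; rw [hx r r' h, hy r r' h]
  | mul x y _ _ hx hy => intro r r' h; simp only [Pi.mul_apply]; rw [hx r r' h, hy r r' h]

/-- Functions of `M_n^{(k)}` depend on the coordinates `< n`. [folklore] -/
theorem depLt_of_mem_mw {n k : ℕ} {f : Dcube → ℝ} (hf : f ∈ Mw n k) : DepLt n f := by
  induction hf using Submodule.span_induction with
  | mem x hx =>
    obtain ⟨K, -, g, hg, rfl⟩ := hx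
    intro r r' h; simp only [Pi.smul_apply]; rw [depLt_of_mem_𝒢L hg r r' h]
  | zero => intro r r' _; rfl
  | add x y _ _ hx hy => intro r r' h; simp only [Pi.add_apply]; rw [hx r r' h, hy r r' h]
  | smul q x _ hx => intro r r' h; simp only [Pi.smul_apply]; rw [hx r r' h]

/-- The evaluation of a weighted family element depends on the coordinates `< n`. [folklore] -/
theorem evF_congr_of_wtIn {n w : ℕ} {F : GH (Let (Fin n)) →₀ (Dcube → ℝ)} (h : WtIn n w F) {r r' : Dcube}
    (hrr' : ∀ k, k < n → r.c k = r'.c k) : evF r F = evF r' F := by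
  ext x; simp only [evF_apply]; exact depLt_of_mem_mw (h x).1 r r' hrr'

end DepLt

/-! ### The step: from level `m+1` to level `m` -/

section Step

open Let

/-- Real scalars commute with the evaluation of coefficient functions. [folklore] -/
theorem evF_real_smul {X D : Type*} (r : D) (K : ℝ) (Φ : X →₀ (D → ℝ)) : evF r (K • Φ) = K • evF r Φ := by
  ext x; simp [evF_apply]

/-- Rational scalars commute with the evaluation of coefficient functions. [folklore] -/
theorem evF_rat_smul {X D : Type*} (r : D) (q : ℚ) (Φ : X →₀ (D → ℝ)) : evF r (q • Φ) = (q : ℝ) • evF r Φ := by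
  ext x; simp [evF_apply, Rat.smul_def]

/-- **Weighted peeling**: functions of `M_{m+1}^{(k)}` are combinations of level-`m` basis functions in
`x_m` with coefficients in `M_m^{(k)}`. [folklore] -/
theorem wpeel {m k : ℕ} {f : Dcube → ℝ} (hf : f ∈ Mw (m + 1) k) :
    ∃ Φ : GB (Let (Fin m)) →₀ (Dcube → ℝ), (∀ β, Φ β ∈ Mw m k) ∧ GBF.ok (σL m) Φ ∧
      ∀ r : Dcube, f r = bevG (σat (σL m) r) (evF r Φ) (r.c m) := by
  classical
  induction hf using Submodule.span_induction with
  | mem x hx =>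
    obtain ⟨K, hK, g, hg, rfl⟩ := hx
    obtain ⟨Φ, hc, ho, hv⟩ := peel hg
    refine ⟨K • Φ, fun β => ?_, fun β hβ => ho β (Finsupp.support_smul hβ), fun r => ?_⟩
    · rw [Finsupp.smul_apply]; exact smul_mem_mw hK (hc β)
    · rw [evF_real_smul, bevG_smul, Pi.smul_apply, hv r, smul_eq_mul]
  | zero => exact ⟨0, fun _ => Submodule.zero_mem _, fun β hβ => by simp at hβ, fun r => by simp⟩
  | add x y _ _ hx hy =>
    obtain ⟨Φ₁, hc₁, ho₁, hv₁⟩ := hx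
    obtain ⟨Φ₂, hc₂, ho₂, hv₂⟩ := hy
    refine ⟨Φ₁ + Φ₂, fun β => by rw [Finsupp.add_apply]; exact Submodule.add_mem _ (hc₁ β) (hc₂ β), fun β hβ => ?_, fun r => ?_⟩
    · rcases Finset.mem_union.1 (Finsupp.support_add hβ) with h | h
      · exact ho₁ β h
      · exact ho₂ β h
    · rw [map_add, bevG_add, Pi.add_apply, hv₁, hv₂]
  | smul q x _ hx =>
    obtain ⟨Φ, hc, ho, hv⟩ := hx
    refine ⟨q • Φ, fun β => by rw [Finsupp.smul_apply]; exact Submodule.smul_mem _ q (hc β),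
      fun β hβ => ho β (Finsupp.support_smul hβ), fun r => ?_⟩
    rw [evF_rat_smul, bevG_smul, Pi.smul_apply, hv r, Rat.smul_def]

/-- Words in the support of the output are doubly regular (syntactically). [folklore] -/
theorem isDReg_of_outA_support {m : ℕ} {F : GH (Let (Fin m)) →₀ (Dcube → ℝ)} {v : List (Let (Fin m))}
    (hv : v ∈ (outA (σL m) z o F).support) : IsDReg v := by
  rcases (outA_support z o hv).2 with h | ⟨V, hV⟩
  · rw [h]; exact isDReg_nil
  · refine ⟨fun hne hlast => ?_, fun hne hhead => ?_⟩
    · have := Shuffle.getLast?_ne_of_mem_support_reg (x := z) (y := o) (by simp) V hV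
      exact this (by rw [List.getLast?_eq_some_getLast hne, hlast])
    · have := Shuffle.head?_ne_of_mem_support_reg z o V hV
      exact this (by rw [List.head?_eq_some_head hne, hhead])

/-- The level-`m` word functional at a parameter. [folklore] -/
def evW (m : ℕ) (r : Dcube) (S : List (Let (Fin m)) →₀ (Dcube → ℝ)) : ℝ :=
  S.sum fun U g => g r * hlogSeries (σat (σL m) r) z (r.c m) U

/-- The word functional of a single. [folklore] -/
theorem evW_single {m : ℕ} (r : Dcube) (U : List (Let (Fin m))) (g : Dcube → ℝ) :
    evW m r (Finsupp.single U g) = g r * hlogSeries (σat (σL m) r) z (r.c m) U := by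
  unfold evW; rw [Finsupp.sum_single_index]; simp

/-- The word functional is additive. [folklore] -/
theorem evW_add {m : ℕ} (r : Dcube) (S T : List (Let (Fin m)) →₀ (Dcube → ℝ)) : evW m r (S + T) = evW m r S + evW m r T := by
  unfold evW; rw [Finsupp.sum_add_index'] <;> intros <;> simp [add_mul]

/-- The word functional of a finite sum. [folklore] -/
theorem evW_finset_sum {m : ℕ} {ι : Type*} (r : Dcube) (s : Finset ι) (S : ι → List (Let (Fin m)) →₀ (Dcube → ℝ)) :
    evW m r (∑ i ∈ s, S i) = ∑ i ∈ s, evW m r (S i) := by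
  classical
  induction s using Finset.induction_on with
  | empty => simp [evW]
  | insert i s hi IH => rw [Finset.sum_insert hi, Finset.sum_insert hi, evW_add, IH]

/-- **The transfer of the output to level `m`**: the word functional of
`T = Σ_v Σ_U δ_{ιU} (E_v)_U · (outA F)_v` is `Σ_v (outA F)_v(r) L_v(1; σ_{m+1}(r))`. [folklore] -/
def transfer (m : ℕ) (out : List (Let (Fin (m + 1))) →₀ (Dcube → ℝ)) : List (Let (Fin m)) →₀ (Dcube → ℝ) :=
  ∑ v ∈ out.support, ∑ U ∈ (uexp v).support, Finsupp.single (U.map (ιL m)) ((uexp v U) • out v)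

/-- **The word functional of the transfer is the value functional of the output**: `Σ_{U'} T_{U'}(r) L_{U'}(x_m; σ_m(r)) = Σ_v (outA F)_v(r) L_v(1; σ_{m+1}(r))` (Theorem T4, universal form, and relabelling). [cite: BrownENS2009, §5.3, §6.3] -/
theorem evW_transfer {m : ℕ} (out : List (Let (Fin (m + 1))) →₀ (Dcube → ℝ))
    (hout : ∀ v ∈ out.support, IsDReg v) (r : Dcube) :
    evW m r (transfer m out) = evH (σat (σL (m + 1)) r) r out := by
  classical
  unfold transfer
  rw [evW_finset_sum, evH, Finsupp.sum]
  refine Finset.sum_congr rfl fun v hv => ?_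
  rw [evW_finset_sum]
  simp only [evW_single, Pi.smul_apply, smul_eq_mul]
  -- `L_v(1; σ_{m+1}(r)) = evalE (πL m r) (uexp v) (x_m) = Σ_U (uexp v)_U L_{ιU}(x_m; σ_m(r))`
  rw [σat_σL_succ, hlogAt1_eq_evalE_uexp (πL_hyp m r) (πL_injective m r) (hout v hv) (r.c_mem m), evalE, Finsupp.sum,
    Finset.mul_sum]
  refine Finset.sum_congr rfl fun U _ => ?_
  rw [hlogSeries_map (σ := τf (πL m r)) (zb := none) rfl (τf_adm (πL_hyp m r)) (σL_z m r) (σL_adm m r) (ιL m)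
    (σL_ιL m r) U (r.c_mem m)]
  ring

/-- The entries of the transfer have the right weights. [folklore] -/
theorem transfer_mem_mw {m w : ℕ} {F : GH (Let (Fin (m + 1))) →₀ (Dcube → ℝ)} (hok : GH.ok (σL (m + 1)) F)
    (h : WtIn (m + 1) w F) (U' : List (Let (Fin m))) :
    transfer m (outA (σL (m + 1)) z o F) U' ∈ Mw (m + 1) (w + 1 - U'.length) := by
  classical
  unfold transfer
  simp only [Finsupp.finsetSum_apply]
  refine Submodule.sum_mem _ fun v hv => Submodule.sum_mem _ fun U hU => ?_
  rw [Finsupp.single_apply]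
  split_ifs with hUU
  · subst hUU
    have hlenU : U.length ≤ v.length := suppLen_uexp v U hU
    have hlenv : v.length ≤ w + 1 := by
      have := (outA_support z o hv).1
      have := maxLenG_le_of_wtIn h
      omega
    have hE : uexp v U ∈ Fil (v.length - U.length) := goodE_uexp v U
    have hO := outA_mem_mw hok h v
    have := fil_smul_mem_mw hE hO
    rw [List.length_map]
    exact mw_mono le_rfl (by omega) this
  · exact Submodule.zero_mem _

/-- **The step.** For a weighted admissible family element `F` of level `m+1` and weight `w` there is
one of level `m` and weight `w+1`, `F'`, whose integrand at every parameter is the fibre integral of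
that of `F`: `Σ F'_{β,U}(r) b_β(x_m) L_U(x_m; σ_m(r)) = ∫₀¹ Σ F_{β,u}(r) b_β(t) L_u(t; σ_{m+1}(r)) dt`
whenever the latter converges. [cite: BrownENS2009, §8.3, Thm 8.2 (mechanism)] -/
theorem step {m w : ℕ} {F : GH (Let (Fin (m + 1))) →₀ (Dcube → ℝ)} (hok : GH.ok (σL (m + 1)) F)
    (hwt : WtIn (m + 1) w F) :
    ∃ F' : GH (Let (Fin m)) →₀ (Dcube → ℝ), GH.ok (σL m) F' ∧ WtIn m (w + 1) F' ∧
      ∀ r : Dcube, IntegrableOn (fun t => hevG (σat (σL (m + 1)) r) z (evF r F) t) (Ioo 0 1) volume →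
        hevG (σat (σL m) r) z (evF r F') (r.c m) = ∫ t in Ioo 0 1, hevG (σat (σL (m + 1)) r) z (evF r F) t := by
  classical
  set out := outA (σL (m + 1)) z o F with hout
  set T := transfer m out with hT
  have hTw : ∀ U', T U' ∈ Mw (m + 1) (w + 1 - U'.length) := fun U' => transfer_mem_mw hok hwt U'
  choose Φ hΦc hΦo hΦv using fun U' => wpeel (hTw U')
  -- `F' (β, U') = Φ U' β` for `U' ∈ T.support`
  refine ⟨∑ U' ∈ T.support, (Φ U').sum fun β g => Finsupp.single (β, U') g, ?_, ?_, fun r hint => ?_⟩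
  · intro x hx
    obtain ⟨U', hU', hx'⟩ := Finset.mem_biUnion.1 (Finsupp.support_finsetSum hx)
    rw [Finsupp.sum] at hx'
    obtain ⟨β, hβ, hx''⟩ := Finset.mem_biUnion.1 (Finsupp.support_finsetSum hx')
    have := Finset.mem_singleton.1 (Finsupp.support_single_subset hx'')
    rw [this]
    exact hΦo U' β hβ
  · intro x
    have hentry : (∑ U' ∈ T.support, (Φ U').sum fun β g => Finsupp.single (β, U') g) x =
        if x.2 ∈ T.support then Φ x.2 x.1 else 0 := by
      rw [Finsupp.finsetSum_apply]
      have hterm : ∀ U', ((Φ U').sum fun β g => Finsupp.single (β, U') g) x = if U' = x.2 then Φ U' x.1 else 0 := by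
        intro U'
        rw [Finsupp.sum, Finsupp.finsetSum_apply]
        split_ifs with hU
        · subst hU
          rw [Finset.sum_eq_single x.1]
          · exact Finsupp.single_eq_same
          · intro β _ hβ; rw [Finsupp.single_apply, if_neg]; intro h; exact hβ (congrArg Prod.fst h)
          · intro hβ; rw [Finsupp.notMem_support_iff.1 hβ]; simp
        · exact Finset.sum_eq_zero fun β _ => by
            rw [Finsupp.single_apply, if_neg]; intro h; exact hU (congrArg Prod.snd h)
      simp only [hterm]
      rw [Finset.sum_ite_eq' T.support x.2 (fun U' => Φ U' x.1)]
    rw [hentry]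
    refine ⟨?_, fun hlt => ?_⟩
    · split_ifs
      · exact hΦc x.2 x.1
      · exact Submodule.zero_mem _
    · rw [if_neg]
      intro hx
      -- entries of `T` at words longer than `w+1` vanish
      have := hTw x.2
      have h0 : w + 1 - x.2.length = 0 := by omega
      -- `T x.2 ≠ 0` but all terms of the transfer at `x.2` vanish by length
      apply Finsupp.mem_support_iff.1 hx
      rw [hT]; unfold transfer
      rw [Finsupp.finsetSum_apply]
      refine Finset.sum_eq_zero fun v hv => ?_
      rw [Finsupp.finsetSum_apply]
      refine Finset.sum_eq_zero fun U hU => ?_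
      rw [Finsupp.single_apply, if_neg]
      intro hUx
      have hlenU : U.length ≤ v.length := suppLen_uexp v U hU
      have hlenv : v.length ≤ w + 1 := by
        have := (outA_support z o hv).1
        have := maxLenG_le_of_wtIn hwt
        omega
      rw [← hUx, List.length_map] at hlt
      omega
  · -- the identity
    rw [integral_hevG_family z o (σL_hZu (m + 1)) (σL_hEu (m + 1)) rfl hok (σL_hZ' (m + 1)) (σL_z (m + 1) r)
      (σL_adm (m + 1) r) (σL_o (m + 1) r) (σL_ne_one (m + 1) r) hint]
    rw [← evW_transfer out (fun v hv => isDReg_of_outA_support hv) r, ← hT]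
    -- left-hand side: `Σ_{U'} bevG (Φ U') · L_{U'}`
    have hlin : ∀ (U' : List (Let (Fin m))) (Ψ : GB (Let (Fin m)) →₀ (Dcube → ℝ)),
        hevG (σat (σL m) r) z (evF r (Ψ.sum fun β g => Finsupp.single (β, U') g)) (r.c m) =
          bevG (σat (σL m) r) (evF r Ψ) (r.c m) * hlogSeries (σat (σL m) r) z (r.c m) U' := by
      intro U' Ψ
      rw [evF_finsupp_sum, hevG_finsupp_sum]
      simp only [evF_single, hevG_single]
      have hsub : (evF r Ψ).support ⊆ Ψ.support := by
        intro β hβ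
        rw [Finsupp.mem_support_iff] at hβ ⊢
        intro h; apply hβ; simp [evF_apply, h]
      rw [Finsupp.sum, bevG, Finsupp.sum_of_support_subset _ hsub _ (by intros; simp), Finset.sum_mul]
      refine Finset.sum_congr rfl fun β _ => ?_
      simp only [evF_apply]; ring
    rw [map_sum, hevG_finset_sum]
    simp only [hlin]
    conv_rhs => rw [← Finsupp.sum_single T, Finsupp.sum, evW_finset_sum]
    refine Finset.sum_congr rfl fun U' _ => ?_
    rw [evW_single, hΦv U' r]

end Step

/-! ### The recursion over the levels (Fubini) -/

section Recursion

open Let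

/-- The open unit cube in `ℝ^N`. [folklore] -/
def cube (N : ℕ) : Set (Fin N → ℝ) := {x | ∀ i, x i ∈ Ioo (0 : ℝ) 1}

/-- The cube as a product set. [folklore] -/
theorem cube_eq_pi (N : ℕ) : cube N = Set.pi Set.univ fun _ => Ioo (0 : ℝ) 1 := by
  ext x; simp [cube]

/-- The cube is measurable. [folklore] -/
theorem measurableSet_cube (N : ℕ) : MeasurableSet (cube N) := by
  rw [cube_eq_pi]; exact MeasurableSet.univ_pi fun _ => measurableSet_Ioo

/-- Extension of finitely many coordinates to a point of the parameter space (padding by `1/2`).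
[folklore] -/
def ext {N : ℕ} (x : Fin N → ℝ) : Dcube :=
  ⟨fun k => if h : k < N then (if x ⟨k, h⟩ ∈ Ioo (0 : ℝ) 1 then x ⟨k, h⟩ else 1 / 2) else 1 / 2, fun k => by
    have h2 : (1 / 2 : ℝ) ∈ Ioo (0 : ℝ) 1 := by norm_num
    by_cases h : k < N
    · simp only [dif_pos h]; split_ifs with hx
      · exact hx
      · exact h2
    · simp only [dif_neg h]; exact h2⟩

/-- The extension restricted to the cube is the identity on the first `N` coordinates. [folklore] -/
theorem ext_c {N : ℕ} {x : Fin N → ℝ} (hx : x ∈ cube N) {k : ℕ} (hk : k < N) : (ext x).c k = x ⟨k, hk⟩ := by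
  simp only [Dcube.c, ext, dif_pos hk, if_pos (hx ⟨k, hk⟩)]

/-- **The integrand of level `n`** of a family element: `Σ F_{β,u}(r) b_β(x_n) L_u(x_n; σ_n(r))`. [folklore] -/
def IL (n : ℕ) (F : GH (Let (Fin n)) →₀ (Dcube → ℝ)) (r : Dcube) : ℝ := hevG (σat (σL n) r) z (evF r F) (r.c n)

/-- The integrand of level `n` only sees the coordinates `< n` of the parameter (and `x_n`). [folklore] -/
theorem IL_eq_slice {n w : ℕ} {F : GH (Let (Fin n)) →₀ (Dcube → ℝ)} (h : WtIn n w F) {r r' : Dcube}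
    (hrr' : ∀ k, k < n → r.c k = r'.c k) : IL n F r = hevG (σat (σL n) r') z (evF r' F) (r.c n) := by
  simp only [IL]; rw [σat_σL_congr hrr', evF_congr_of_wtIn h hrr']

/-- A fixed parameter. [folklore] -/
def rHalf : Dcube := ⟨fun _ => 1 / 2, fun _ => by norm_num⟩

/-- At level `0` the alphabet is `{z ↦ 0, o ↦ 1}` and the values at `1` are multiple zeta values.
[folklore] -/
theorem hlogAt1_σL_zero_mem {v : List (Let (Fin 0))} (hv : IsDReg v) (r : Dcube) :
    hlogAt1 (σat (σL 0) r) v ∈ Fil v.length := by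
  have hσ : σat (σL 0) r = σf (fun a : Fin 0 => a.elim0) (1 / 2) := by
    funext a
    cases a with
    | z => rfl
    | o => rfl
    | mv a => exact a.elim0
  have hnm : ∀ c : Fin 0, mv c ∉ v := fun c => c.elim0
  rw [hσ, hlogAt1_σf_of_noMoving hv hnm]
  have hK := kconst_mem hv
  simp only [Kconst] at hK
  rwa [if_neg (by rintro ⟨c, -⟩; exact c.elim0)] at hK

/-- **The base of the recursion** (level `0`, one variable): `∫₀¹ Σ F_{β,u} b_β L_u ∈ 𝒵_{≤ w+1}`.
[cite: BrownENS2009, Thm 8.2 (n = 4 case, mechanism)] -/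
theorem recursion_zero {w : ℕ} {F : GH (Let (Fin 0)) →₀ (Dcube → ℝ)} (hok : GH.ok (σL 0) F) (hwt : WtIn 0 w F)
    (hint : IntegrableOn (fun x : Fin 1 → ℝ => IL 0 F (ext x)) (cube 1) volume) :
    (∫ x in cube 1, IL 0 F (ext x)) ∈ Fil (w + 1) := by
  set S : ℝ → ℝ := fun t => hevG (σat (σL 0) rHalf) z (evF rHalf F) t with hS
  have hIL : ∀ x ∈ cube 1, IL 0 F (ext x) = S (x 0) := by
    intro x hx
    rw [IL_eq_slice hwt (r' := rHalf) (fun k hk => absurd hk (Nat.not_lt_zero k)), ext_c hx Nat.zero_lt_one]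
    rfl
  set e := MeasurableEquiv.funUnique (Fin 1) ℝ with he
  have hem : MeasurePreserving e := volume_preserving_funUnique (Fin 1) ℝ
  have hpre : e ⁻¹' Ioo (0 : ℝ) 1 = cube 1 := by
    ext x
    simp only [Set.mem_preimage, cube, Set.mem_setOf_eq, Fin.forall_fin_one]
    rfl
  have heq : (∫ x in cube 1, IL 0 F (ext x)) = ∫ t in Ioo (0 : ℝ) 1, S t := by
    rw [setIntegral_congr_fun (measurableSet_cube 1) hIL, ← hpre]
    exact hem.setIntegral_preimage_emb e.measurableEmbedding S (Ioo 0 1)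
  have hintS : IntegrableOn S (Ioo (0 : ℝ) 1) volume := by
    rw [← hem.integrableOn_comp_preimage e.measurableEmbedding, hpre]
    exact hint.congr_fun hIL (measurableSet_cube 1)
  rw [heq, hS, integral_hevG_family z o (σL_hZu 0) (σL_hEu 0) rfl hok (σL_hZ' 0) (σL_z 0 rHalf) (σL_adm 0 rHalf)
    (σL_o 0 rHalf) (σL_ne_one 0 rHalf) hintS, evH, Finsupp.sum]
  refine Submodule.sum_mem _ fun v hv => ?_
  have hlen : v.length ≤ w + 1 := by
    have := (outA_support z o hv).1
    have := maxLenG_le_of_wtIn hwt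
    omega
  have h1 : outA (σL 0) z o F v rHalf ∈ Fil (w + 1 - v.length) := apply_mem_fil_of_mem_mw_zero (outA_mem_mw hok hwt v) rHalf
  have h2 := hlogAt1_σL_zero_mem (isDReg_of_outA_support hv) rHalf
  have := fil_mul_mem h1 h2
  exact fil_mono (by omega) this

/-- Coordinates of `insertNth (last (m+1)) y x'` below the top. [folklore] -/
theorem insertNth_last_lt {m : ℕ} (y : ℝ) (x' : Fin (m + 1) → ℝ) {k : ℕ} (hk : k < m + 1) :
    @Fin.insertNth (m + 1) (fun _ => ℝ) (Fin.last (m + 1)) y x' ⟨k, Nat.lt_succ_of_lt hk⟩ = x' ⟨k, hk⟩ := by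
  have : (⟨k, Nat.lt_succ_of_lt hk⟩ : Fin (m + 2)) = (Fin.last (m + 1)).succAbove ⟨k, hk⟩ := by
    rw [Fin.succAbove_last]; rfl
  rw [this, Fin.insertNth_apply_succAbove]

/-- The top coordinate of `insertNth (last (m+1)) y x'`. [folklore] -/
theorem insertNth_last_top {m : ℕ} (y : ℝ) (x' : Fin (m + 1) → ℝ) :
    @Fin.insertNth (m + 1) (fun _ => ℝ) (Fin.last (m + 1)) y x' ⟨m + 1, Nat.lt_succ_self _⟩ = y := by
  have : (⟨m + 1, Nat.lt_succ_self _⟩ : Fin (m + 2)) = Fin.last (m + 1) := rfl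
  rw [this, Fin.insertNth_apply_same]

/-- **The recursion** (Fubini over the last coordinate, the step, induction on the level):
for a weighted admissible family element `F` of level `n` and weight `w` whose integrand is integrable
on the cube, `∫_{(0,1)^{n+1}} Σ F_{β,u}(x) b_β(x_n) L_u(x_n; σ_n(x)) dx ∈ 𝒵_{≤ w+n+1}`.
[cite: BrownENS2009, §8.3, Thm 8.2] -/
theorem recursion : ∀ (n w : ℕ) (F : GH (Let (Fin n)) →₀ (Dcube → ℝ)), GH.ok (σL n) F → WtIn n w F →
    IntegrableOn (fun x : Fin (n + 1) → ℝ => IL n F (ext x)) (cube (n + 1)) volume →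
    (∫ x in cube (n + 1), IL n F (ext x)) ∈ Fil (w + n + 1) := by
  intro n
  induction n with
  | zero => intro w F hok hwt hint; simpa using recursion_zero hok hwt hint
  | succ m IH =>
    intro w F hok hwt hint
    obtain ⟨F', hok', hwt', hstep⟩ := step hok hwt
    -- split off the last coordinate
    set e : ℝ × (Fin (m + 1) → ℝ) ≃ᵐ (Fin (m + 2) → ℝ) := (MeasurableEquiv.piFinSuccAbove (fun _ => ℝ) (Fin.last (m + 1))).symm
      with he_def
    have he : ∀ (y : ℝ) (x' : Fin (m + 1) → ℝ), e (y, x') = Fin.insertNth (Fin.last (m + 1)) y x' := fun _ _ => rfl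
    have hem : MeasurePreserving e := (volume_preserving_piFinSuccAbove (fun _ : Fin (m + 2) => ℝ) (Fin.last (m + 1))).symm _
    have hpre : e ⁻¹' cube (m + 2) = Ioo (0 : ℝ) 1 ×ˢ cube (m + 1) := by
      ext ⟨y, x'⟩
      simp only [Set.mem_preimage, he, cube, Set.mem_setOf_eq, Set.mem_prod]
      rw [Fin.forall_iff_succAbove (Fin.last (m + 1))]
      simp only [Fin.insertNth_apply_same, Fin.insertNth_apply_succAbove]
    set G : (Fin (m + 2) → ℝ) → ℝ := fun x => IL (m + 1) F (ext x) with hG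
    -- the slices
    have hslice : ∀ x' ∈ cube (m + 1), ∀ y ∈ Ioo (0 : ℝ) 1,
        G (e (y, x')) = hevG (σat (σL (m + 1)) (ext x')) z (evF (ext x') F) y := by
      intro x' hx' y hy
      have hmem : e (y, x') ∈ cube (m + 2) := by
        have : (y, x') ∈ e ⁻¹' cube (m + 2) := by rw [hpre]; exact ⟨hy, hx'⟩
        exact this
      simp only [hG]
      rw [IL_eq_slice hwt (r' := ext x') (fun k hk => by
        rw [ext_c hmem (by omega), ext_c hx' hk, he, insertNth_last_lt]), ext_c hmem (by omega), he, insertNth_last_top]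
    -- integrability on the product
    have hintG : IntegrableOn (G ∘ e) (Ioo (0 : ℝ) 1 ×ˢ cube (m + 1)) (volume.prod volume) := by
      rw [← Measure.volume_eq_prod, ← hpre]
      exact (hem.integrableOn_comp_preimage e.measurableEmbedding).2 hint
    have hintG' : Integrable (G ∘ e) ((volume.restrict (Ioo (0 : ℝ) 1)).prod (volume.restrict (cube (m + 1)))) := by
      rw [Measure.prod_restrict]; exact hintG
    -- Fubini
    have hfub : (∫ x in cube (m + 2), G x) = ∫ x' in cube (m + 1), ∫ y in Ioo (0 : ℝ) 1, G (e (y, x')) := by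
      rw [← hem.setIntegral_preimage_emb e.measurableEmbedding G (cube (m + 2)), hpre, Measure.volume_eq_prod,
        ← Measure.prod_restrict]
      exact integral_prod_symm (fun p : ℝ × (Fin (m + 1) → ℝ) => G (e p)) hintG'
    -- a.e. slice integrability and the step
    have hae : ∀ᵐ x' ∂(volume.restrict (cube (m + 1))), IntegrableOn (fun y => G (e (y, x'))) (Ioo (0 : ℝ) 1) volume :=
      hintG'.prod_left_ae
    have hae' : ∀ᵐ x' ∂(volume.restrict (cube (m + 1))),
        (∫ y in Ioo (0 : ℝ) 1, G (e (y, x'))) = IL m F' (ext x') := by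
      filter_upwards [hae, ae_restrict_mem (measurableSet_cube (m + 1))] with x' hx'int hx'
      have hcongr : ∀ y ∈ Ioo (0 : ℝ) 1, G (e (y, x')) = hevG (σat (σL (m + 1)) (ext x')) z (evF (ext x') F) y :=
        hslice x' hx'
      rw [setIntegral_congr_fun measurableSet_Ioo hcongr]
      have hint' : IntegrableOn (fun y => hevG (σat (σL (m + 1)) (ext x')) z (evF (ext x') F) y) (Ioo 0 1) volume :=
        hx'int.congr_fun hcongr measurableSet_Ioo
      rw [← hstep (ext x') hint']
      simp only [IL, ext_c hx' (Nat.lt_succ_self m)]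
    have hF'int : IntegrableOn (fun x' : Fin (m + 1) → ℝ => IL m F' (ext x')) (cube (m + 1)) volume := by
      have h1 : Integrable (fun x' => ∫ y, (G ∘ e) (y, x') ∂(volume.restrict (Ioo (0 : ℝ) 1))) (volume.restrict (cube (m + 1))) :=
        hintG'.integral_prod_right
      exact h1.congr hae'
    have := IH (w + 1) F' hok' hwt' hF'int
    rw [show w + (m + 1) + 1 = w + 1 + m + 1 by ring]
    rw [hfub, integral_congr_ae hae']
    exact this

end Recursion

/-! ### The cubical coordinates of the simplex -/

section Cubical

open Let

variable {ℓ : ℕ}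

/-- **The cubical coordinates**: `φ(x)_i = x_0 x_1 ⋯ x_i`, a bijection of the open cube onto the
open ordered simplex `1 > t_0 > t_1 > ⋯ > t_{ℓ-1} > 0`. [cite: BrownENS2009, §2.2 (cubical coordinates)] -/
def φc (x : Fin ℓ → ℝ) : Fin ℓ → ℝ := fun i => ∏ j ∈ Finset.Iic i, x j

/-- `φ(x)_i = x_i · (x_0 ⋯ x_{i-1})`. [folklore] -/
theorem φc_eq_mul (x : Fin ℓ → ℝ) (i : Fin ℓ) : φc x i = x i * ∏ j ∈ Finset.Iio i, x j := by
  classical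
  simp only [φc]
  rw [← Finset.Iio_insert, Finset.prod_insert (by simp)]

/-- The cubical coordinates are positive on the cube. [folklore] -/
theorem φc_pos {x : Fin ℓ → ℝ} (hx : x ∈ cube ℓ) (i : Fin ℓ) : 0 < φc x i :=
  Finset.prod_pos fun j _ => (hx j).1

/-- Partial products of cube coordinates are positive. [folklore] -/
theorem prod_Iio_pos {x : Fin ℓ → ℝ} (hx : x ∈ cube ℓ) (i : Fin ℓ) : 0 < ∏ j ∈ Finset.Iio i, x j :=
  Finset.prod_pos fun j _ => (hx j).1

/-- Partial products of cube coordinates are `≤ 1`. [folklore] -/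
theorem prod_Iio_le_one {x : Fin ℓ → ℝ} (hx : x ∈ cube ℓ) (i : Fin ℓ) : ∏ j ∈ Finset.Iio i, x j ≤ 1 :=
  Finset.prod_le_one (fun j _ => (hx j).1.le) fun j _ => (hx j).2.le

/-- The cubical coordinates are `< 1` on the cube. [folklore] -/
theorem φc_lt_one {x : Fin ℓ → ℝ} (hx : x ∈ cube ℓ) (i : Fin ℓ) : φc x i < 1 := by
  rw [φc_eq_mul]
  calc x i * ∏ j ∈ Finset.Iio i, x j ≤ x i * 1 := mul_le_mul_of_nonneg_left (prod_Iio_le_one hx i) (hx i).1.le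
    _ < 1 := by rw [mul_one]; exact (hx i).2

/-- The cubical coordinates are strictly decreasing in the index. [folklore] -/
theorem φc_strictAnti {x : Fin ℓ → ℝ} (hx : x ∈ cube ℓ) : StrictAnti (φc x) := by
  intro i j hij
  simp only [φc]
  have hsub : Finset.Iic i ⊆ Finset.Iic j := Finset.Iic_subset_Iic.2 hij.le
  rw [← Finset.prod_sdiff hsub]
  have hj : j ∈ Finset.Iic j \ Finset.Iic i := by simp [Finset.mem_sdiff, not_le.mpr hij]
  have hlt : ∏ k ∈ Finset.Iic j \ Finset.Iic i, x k < 1 := by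
    rw [← Finset.mul_prod_erase _ _ hj]
    calc x j * ∏ k ∈ (Finset.Iic j \ Finset.Iic i).erase j, x k ≤ x j * 1 :=
          mul_le_mul_of_nonneg_left (Finset.prod_le_one (fun k _ => (hx k).1.le) fun k _ => (hx k).2.le) (hx j).1.le
      _ < 1 := by rw [mul_one]; exact (hx j).2
  have hpos : 0 < ∏ k ∈ Finset.Iic i, x k := Finset.prod_pos fun k _ => (hx k).1
  calc (∏ k ∈ Finset.Iic j \ Finset.Iic i, x k) * ∏ k ∈ Finset.Iic i, x k < 1 * ∏ k ∈ Finset.Iic i, x k :=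
        mul_lt_mul_of_pos_right hlt hpos
    _ = ∏ k ∈ Finset.Iic i, x k := one_mul _

/-- The cube is carried into the simplex. [folklore] -/
theorem φc_mem_simplex {x : Fin ℓ → ℝ} (hx : x ∈ cube ℓ) : φc x ∈ KZ.openOrderedSimplex ℓ :=
  ⟨φc_pos hx, φc_lt_one hx, φc_strictAnti hx⟩

/-- The cubical coordinates are injective on the cube. [folklore] -/
theorem φc_injOn : Set.InjOn (φc (ℓ := ℓ)) (cube ℓ) := by
  intro x hx x' hx' h
  -- by strong induction on the index
  have key : ∀ n : ℕ, ∀ i : Fin ℓ, (i : ℕ) = n → x i = x' i := by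
    intro n
    induction n using Nat.strong_induction_on with
    | _ n IH =>
      intro i hi
      have hi' := congrFun h i
      rw [φc_eq_mul, φc_eq_mul] at hi'
      have hprod : ∏ j ∈ Finset.Iio i, x j = ∏ j ∈ Finset.Iio i, x' j :=
        Finset.prod_congr rfl fun j hj => IH j (by have := Finset.mem_Iio.1 hj; rw [← hi]; exact this) j rfl
      rw [hprod] at hi'
      exact mul_right_cancel₀ (prod_Iio_pos hx' i).ne' hi'
  funext i; exact key i i rfl

/-- The previous coordinate (`1` before the first). [folklore] -/
def tprev (t : Fin ℓ → ℝ) (i : Fin ℓ) : ℝ := if h : (i : ℕ) = 0 then 1 else t ⟨(i : ℕ) - 1, by omega⟩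

/-- On the simplex, `t_i < t_{i-1}` (`t_{-1} = 1`). [folklore] -/
theorem tprev_gt {t : Fin ℓ → ℝ} (ht : t ∈ KZ.openOrderedSimplex ℓ) (i : Fin ℓ) : t i < tprev t i := by
  unfold tprev
  split_ifs with h
  · exact ht.2.1 i
  · exact ht.2.2 (Fin.lt_def.mpr (by simp; omega))

/-- On the simplex, `t_{i-1} ≤ 1`. [folklore] -/
theorem tprev_le_one {t : Fin ℓ → ℝ} (ht : t ∈ KZ.openOrderedSimplex ℓ) (i : Fin ℓ) : tprev t i ≤ 1 := by
  unfold tprev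
  split_ifs with h
  · exact le_rfl
  · exact (ht.2.1 _).le

/-- The inverse of the cubical coordinates: `x_i = t_i / t_{i-1}`. [folklore] -/
def ψc (t : Fin ℓ → ℝ) : Fin ℓ → ℝ := fun i => t i / tprev t i

/-- The inverse coordinates of a point of the simplex lie in the cube. [folklore] -/
theorem ψc_mem_cube {t : Fin ℓ → ℝ} (ht : t ∈ KZ.openOrderedSimplex ℓ) : ψc t ∈ cube ℓ := by
  intro i
  have h1 := tprev_gt ht i
  have h0 := ht.1 i
  have hp : 0 < tprev t i := h0.trans h1
  exact ⟨div_pos h0 hp, (div_lt_one hp).2 h1⟩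

/-- `φ ∘ ψ = id` on the simplex (telescoping). [folklore] -/
theorem φc_ψc {t : Fin ℓ → ℝ} (ht : t ∈ KZ.openOrderedSimplex ℓ) : φc (ψc t) = t := by
  have key : ∀ n : ℕ, ∀ i : Fin ℓ, (i : ℕ) = n → φc (ψc t) i = t i := by
    intro n
    induction n using Nat.strong_induction_on with
    | _ n IH =>
      intro i hi
      rw [φc_eq_mul]
      have hp : 0 < tprev t i := (ht.1 i).trans (tprev_gt ht i)
      by_cases h0 : (i : ℕ) = 0
      · have hIio : Finset.Iio i = ∅ := by
          ext j; simp only [Finset.mem_Iio, Finset.notMem_empty, iff_false, not_lt]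
          exact Fin.le_def.mpr (by omega)
        rw [hIio, Finset.prod_empty, mul_one]
        simp only [ψc, tprev, dif_pos h0, div_one]
      · -- `Iio i = Iic (i-1)`
        set i' : Fin ℓ := ⟨(i : ℕ) - 1, by omega⟩ with hi'
        have hIio : Finset.Iio i = Finset.Iic i' := by
          ext j; simp only [Finset.mem_Iio, Finset.mem_Iic, Fin.lt_def, Fin.le_def, hi']; omega
        rw [hIio]
        have := IH ((i : ℕ) - 1) (by omega) i' rfl
        simp only [φc] at this
        rw [this]
        simp only [ψc, tprev, dif_neg h0]
        rw [← hi']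
        have hne : t i' ≠ 0 := (ht.1 i').ne'
        field_simp
  funext i; exact key i i rfl

/-- **The image of the cube is the simplex.** [folklore] -/
theorem φc_image : φc '' cube ℓ = KZ.openOrderedSimplex ℓ := by
  ext t
  constructor
  · rintro ⟨x, hx, rfl⟩; exact φc_mem_simplex hx
  · intro ht; exact ⟨ψc t, ψc_mem_cube ht, φc_ψc ht⟩

/-! #### The Jacobian -/

/-- The Jacobian matrix of the cubical coordinates (lower triangular). [folklore] -/
def Jc (x : Fin ℓ → ℝ) : Matrix (Fin ℓ) (Fin ℓ) ℝ := fun i j => if j ≤ i then ∏ k ∈ (Finset.Iic i).erase j, x k else 0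

/-- The derivative of the cubical coordinates. [folklore] -/
def φc' (x : Fin ℓ → ℝ) : (Fin ℓ → ℝ) →L[ℝ] (Fin ℓ → ℝ) :=
  ContinuousLinearMap.pi fun i => ∑ j ∈ Finset.Iic i, (∏ k ∈ (Finset.Iic i).erase j, x k) • ContinuousLinearMap.proj j

/-- The cubical coordinates are differentiable with derivative `φc'`. [folklore] -/
theorem hasFDerivAt_φc (x : Fin ℓ → ℝ) : HasFDerivAt (φc (ℓ := ℓ)) (φc' x) x := by
  classical
  unfold φc φc'
  rw [hasFDerivAt_pi]
  intro i
  exact HasFDerivAt.finsetProd fun j _ => hasFDerivAt_apply j x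

/-- The derivative is the linear map of the Jacobian matrix. [folklore] -/
theorem φc'_eq_toLin' (x : Fin ℓ → ℝ) : (φc' x : (Fin ℓ → ℝ) →ₗ[ℝ] (Fin ℓ → ℝ)) = Matrix.toLin' (Jc x) := by
  classical
  refine LinearMap.ext fun v => funext fun i => ?_
  simp only [ContinuousLinearMap.coe_coe, φc', ContinuousLinearMap.pi_apply, FunLike.coe_sum,
    FunLike.coe_smul, Finset.sum_apply, Pi.smul_apply, ContinuousLinearMap.proj_apply, smul_eq_mul,
    Matrix.toLin'_apply, Matrix.mulVec, dotProduct, Jc, ite_mul, zero_mul]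
  rw [← Finset.sum_filter]
  refine Finset.sum_congr ?_ fun j _ => rfl
  ext j; simp

/-- **The Jacobian determinant**: `det φ'(x) = ∏_i x_0 ⋯ x_{i-1} = ∏_k x_k^{ℓ-1-k}`. [cite: BrownENS2009, §2.2] -/
theorem det_φc' (x : Fin ℓ → ℝ) : (φc' x).det = ∏ i : Fin ℓ, ∏ k ∈ Finset.Iio i, x k := by
  classical
  rw [ContinuousLinearMap.det, φc'_eq_toLin', LinearMap.det_toLin']
  have htri : (Jc x).BlockTriangular OrderDual.toDual := by
    intro i j hij
    have hij' : i < j := hij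
    simp only [Jc, if_neg (not_le.mpr hij')]
  rw [Matrix.det_of_lowerTriangular _ htri]
  refine Finset.prod_congr rfl fun i _ => ?_
  simp only [Jc, le_refl, if_true, Finset.Iic_erase]

/-- The Jacobian determinant is positive on the cube. [folklore] -/
theorem det_φc'_pos {x : Fin ℓ → ℝ} (hx : x ∈ cube ℓ) : 0 < (φc' x).det := by
  rw [det_φc']; exact Finset.prod_pos fun i _ => prod_Iio_pos hx i

/-- **Change of variables to cubical coordinates.** [folklore] -/
theorem integral_simplex_eq_integral_cube (g : (Fin ℓ → ℝ) → ℝ) :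
    (∫ t in KZ.openOrderedSimplex ℓ, g t) = ∫ x in cube ℓ, (φc' x).det * g (φc x) := by
  rw [← φc_image, integral_image_eq_integral_abs_det_fderiv_smul volume (measurableSet_cube ℓ)
    (fun x _ => (hasFDerivAt_φc x).hasFDerivWithinAt) φc_injOn g]
  refine setIntegral_congr_fun (measurableSet_cube ℓ) fun x hx => ?_
  rw [smul_eq_mul, abs_of_pos (det_φc'_pos hx)]

/-- **Change of variables to cubical coordinates** (integrability). [folklore] -/
theorem integrableOn_simplex_iff (g : (Fin ℓ → ℝ) → ℝ) :
    IntegrableOn g (KZ.openOrderedSimplex ℓ) volume ↔ IntegrableOn (fun x => (φc' x).det * g (φc x)) (cube ℓ) volume := by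
  rw [← φc_image, integrableOn_image_iff_integrableOn_abs_det_fderiv_smul volume (measurableSet_cube ℓ)
    (fun x _ => (hasFDerivAt_φc x).hasFDerivWithinAt) φc_injOn g]
  exact integrableOn_congr_fun (fun x hx => by rw [smul_eq_mul, abs_of_pos (det_φc'_pos hx)]) (measurableSet_cube ℓ)

/-- The cubical coordinates in terms of the parameter space: `φ(x)_i = pr (ext x) 0 (i+1)`. [folklore] -/
theorem φc_eq_pr {x : Fin ℓ → ℝ} (hx : x ∈ cube ℓ) (i : Fin ℓ) : φc x i = (ext x).pr 0 (i + 1) := by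
  simp only [φc, Dcube.pr]
  -- reindex `Iic i ≃ range (i+1)` along `Fin.val`
  refine Finset.prod_nbij (fun j : Fin ℓ => (j : ℕ)) (fun j hj => ?_) (fun j _ j' _ h => Fin.ext h) (fun k hk => ?_)
    (fun j _ => ?_)
  · have hj' := Finset.mem_Iic.1 hj
    exact Finset.mem_Ico.2 ⟨Nat.zero_le _, Nat.lt_succ_of_le (Fin.le_def.mp hj')⟩
  · have hk' := Finset.mem_Ico.1 (Finset.mem_coe.1 hk)
    refine ⟨⟨k, by omega⟩, Finset.mem_coe.2 (Finset.mem_Iic.2 (Fin.le_def.mpr (by simp; omega))), rfl⟩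
  · rw [ext_c hx j.isLt]

/-- Partial products in terms of the parameter space. [folklore] -/
theorem prod_Iio_eq_pr {x : Fin ℓ → ℝ} (hx : x ∈ cube ℓ) (i : Fin ℓ) : ∏ k ∈ Finset.Iio i, x k = (ext x).pr 0 i := by
  simp only [Dcube.pr]
  refine Finset.prod_nbij (fun j : Fin ℓ => (j : ℕ)) (fun j hj => ?_) (fun j _ j' _ h => Fin.ext h) (fun k hk => ?_)
    (fun j _ => ?_)
  · have hj' := Finset.mem_Iio.1 hj
    exact Finset.mem_Ico.2 ⟨Nat.zero_le _, Fin.lt_def.mp hj'⟩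
  · have hk' := Finset.mem_Ico.1 (Finset.mem_coe.1 hk)
    refine ⟨⟨k, by omega⟩, Finset.mem_coe.2 (Finset.mem_Iio.2 (Fin.lt_def.mpr (by simp; omega))), rfl⟩
  · rw [ext_c hx j.isLt]

end Cubical

/-! ### The assembly: Brown's theorem for the standard cell -/

section Final

open Let

/-- Blocks with a fixed word: `Σ_β Ψ_β(r) b_β(t) L_U(t)`. [folklore] -/
theorem hevG_block {m : ℕ} (r : Dcube) (U : List (Let (Fin m))) (Ψ : GB (Let (Fin m)) →₀ (Dcube → ℝ)) (t : ℝ) :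
    hevG (σat (σL m) r) z (evF r (Ψ.sum fun β g => Finsupp.single (β, U) g)) t =
      bevG (σat (σL m) r) (evF r Ψ) t * hlogSeries (σat (σL m) r) z t U := by
  classical
  rw [evF_finsupp_sum, hevG_finsupp_sum]
  simp only [evF_single, hevG_single]
  have hsub : (evF r Ψ).support ⊆ Ψ.support := by
    intro β hβ
    rw [Finsupp.mem_support_iff] at hβ ⊢
    intro h; apply hβ; simp [evF_apply, h]
  rw [Finsupp.sum, bevG, Finsupp.sum_of_support_subset _ hsub _ (by intros; simp), Finset.sum_mul]
  refine Finset.sum_congr rfl fun β _ => ?_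
  simp only [evF_apply]; ring

/-- **Integrals of functions of `𝒢_{n+1}` over the cube are multiple zeta values of weight `≤ n+1`.**
[cite: BrownENS2009, Thm 8.2 (mechanism)] -/
theorem integral_cube_mem {n : ℕ} {G : Dcube → ℝ} (hG : G ∈ 𝒢L (n + 1))
    (hint : IntegrableOn (fun x : Fin (n + 1) → ℝ => G (ext x)) (cube (n + 1)) volume) :
    (∫ x in cube (n + 1), G (ext x)) ∈ Fil (n + 1) := by
  classical
  obtain ⟨Φ, hc, ho, hv⟩ := peel hG
  set F₀ : GH (Let (Fin n)) →₀ (Dcube → ℝ) := Φ.sum fun β g => Finsupp.single (β, ([] : List (Let (Fin n)))) g with hF₀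
  have hIL : ∀ r, IL n F₀ r = G r := by
    intro r
    simp only [IL, hF₀]
    rw [hevG_block, hlogSeries_nil (σL_z n r) (σL_adm n r) (r.c_mem n), mul_one, hv r]
  have hok : GH.ok (σL n) F₀ := by
    intro x hx
    rw [hF₀, Finsupp.sum] at hx
    obtain ⟨β, hβ, hx'⟩ := Finset.mem_biUnion.1 (Finsupp.support_finsetSum hx)
    rw [Finset.mem_singleton.1 (Finsupp.support_single_subset hx')]
    exact ho β hβ
  have hwt : WtIn n 0 F₀ := by
    intro x
    have hentry : F₀ x = if x.2 = [] then Φ x.1 else 0 := by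
      rw [hF₀, Finsupp.sum, Finsupp.finsetSum_apply]
      split_ifs with h2
      · rw [Finset.sum_eq_single x.1]
        · rw [Finsupp.single_apply, if_pos]; ext <;> simp [h2]
        · intro β _ hβ; rw [Finsupp.single_apply, if_neg]; intro h; exact hβ (congrArg Prod.fst h)
        · intro hβ; rw [Finsupp.notMem_support_iff.1 hβ]; simp
      · exact Finset.sum_eq_zero fun β _ => by
          rw [Finsupp.single_apply, if_neg]; intro h; exact h2 ((congrArg Prod.snd h).symm)
    rw [hentry]
    refine ⟨?_, fun hlt => ?_⟩
    · split_ifs with h2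
      · exact mem_mw_of_mem_𝒢L (hc x.1)
      · exact Submodule.zero_mem _
    · rw [if_neg]; intro h2; rw [h2] at hlt; exact absurd hlt (by simp)
  have hIL' : ∀ x ∈ cube (n + 1), IL n F₀ (ext x) = G (ext x) := fun x _ => hIL (ext x)
  have h := recursion n 0 F₀ hok hwt (hint.congr_fun (fun x hx => (hIL' x hx).symm) (measurableSet_cube _))
  rw [setIntegral_congr_fun (measurableSet_cube _) hIL'] at h
  simpa using h

variable {ℓ : ℕ}

/-- The integrand of the theorem. [cite: BrownENS2009, §2.1] -/
def gInt (p : MvPolynomial (Fin ℓ) ℚ) (a : Fin ℓ → Fin ℓ → ℕ) (b c : Fin ℓ → ℕ) (t : Fin ℓ → ℝ) : ℝ :=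
  MvPolynomial.aeval t p / ((∏ i, t i ^ b i) * (∏ i, (1 - t i) ^ c i) * ∏ i, ∏ j, if i < j then (t i - t j) ^ a i j else 1)

/-- The coordinate functions `t_i = x_0 ⋯ x_i` on the parameter space. [folklore] -/
def Tc (i : Fin ℓ) : Dcube → ℝ := fun r => r.pr 0 (i + 1)

/-- The coordinate functions `t_i` are in `𝒢_ℓ`. [folklore] -/
theorem Tc_mem (i : Fin ℓ) : Tc i ∈ 𝒢L ℓ := pr_mem i.isLt

/-- The denominator as a function on the parameter space. [folklore] -/
def Den (a : Fin ℓ → Fin ℓ → ℕ) (b c : Fin ℓ → ℕ) : Dcube → ℝ :=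
  (∏ i, Tc i ^ b i) * (∏ i, (1 - Tc i) ^ c i) * ∏ i, ∏ j, if i < j then (Tc i - Tc j) ^ a i j else 1

/-- The integrand in cubical coordinates times the Jacobian, as a function on the parameter space.
[folklore] -/
def GInt (p : MvPolynomial (Fin ℓ) ℚ) (a : Fin ℓ → Fin ℓ → ℕ) (b c : Fin ℓ → ℕ) : Dcube → ℝ :=
  (fun r => ∏ i : Fin ℓ, r.pr 0 i) * MvPolynomial.aeval Tc p * (Den a b c)⁻¹

/-- Polynomials in the `t_i` are in `𝒢_ℓ`. [folklore] -/
theorem aeval_Tc_mem (p : MvPolynomial (Fin ℓ) ℚ) : MvPolynomial.aeval (Tc (ℓ := ℓ)) p ∈ 𝒢L ℓ := by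
  induction p using MvPolynomial.induction_on with
  | C q => rw [MvPolynomial.aeval_C]; exact Subalgebra.algebraMap_mem _ _
  | add p q hp hq => rw [map_add]; exact Subalgebra.add_mem _ hp hq
  | mul_X p i hp => rw [map_mul, MvPolynomial.aeval_X]; exact Subalgebra.mul_mem _ hp (Tc_mem i)

/-- `1/t_i ∈ 𝒢_ℓ`. [folklore] -/
theorem inv_Tc_mem (i : Fin ℓ) : (Tc i)⁻¹ ∈ 𝒢L ℓ := pr_inv_mem i.isLt

/-- `1/(1 - t_i) ∈ 𝒢_ℓ`. [folklore] -/
theorem inv_one_sub_Tc_mem (i : Fin ℓ) : (1 - Tc i)⁻¹ ∈ 𝒢L ℓ := by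
  have h := inv_one_sub_pr_mem (n := (i : ℕ) + 1) (a := 0) (Nat.succ_pos _)
  exact 𝒢L_mono i.isLt h

/-- `1/(t_i - t_j) = (1/t_i) · 1/(1 - x_{i+1} ⋯ x_j) ∈ 𝒢_ℓ` for `i < j`. [folklore] -/
theorem inv_Tc_sub_Tc_mem {i j : Fin ℓ} (hij : i < j) : (Tc i - Tc j)⁻¹ ∈ 𝒢L ℓ := by
  have hfac : (Tc i - Tc j)⁻¹ = (fun r : Dcube => (r.pr 0 (i + 1))⁻¹) * fun r => (1 - r.pr (i + 1) (j + 1))⁻¹ := by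
    funext r
    simp only [Tc, Pi.inv_apply, Pi.sub_apply, Pi.mul_apply]
    rw [r.pr_split (Nat.zero_le _) (by omega : (i : ℕ) + 1 ≤ j + 1), ← mul_inv, mul_sub, mul_one]
  rw [hfac]
  exact Subalgebra.mul_mem _ (pr_inv_mem i.isLt) (𝒢L_mono j.isLt (inv_one_sub_pr_mem (by omega)))

/-- The inverse of the denominator is in `𝒢_ℓ`. [folklore] -/
theorem inv_Den_mem (a : Fin ℓ → Fin ℓ → ℕ) (b c : Fin ℓ → ℕ) : (Den a b c)⁻¹ ∈ 𝒢L ℓ := by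
  unfold Den
  rw [mul_inv, mul_inv, ← Finset.prod_inv_distrib, ← Finset.prod_inv_distrib, ← Finset.prod_inv_distrib]
  refine Subalgebra.mul_mem _ (Subalgebra.mul_mem _ ?_ ?_) ?_
  · exact Subalgebra.prod_mem _ fun i _ => by rw [← inv_pow]; exact Subalgebra.pow_mem _ (inv_Tc_mem i) _
  · exact Subalgebra.prod_mem _ fun i _ => by rw [← inv_pow]; exact Subalgebra.pow_mem _ (inv_one_sub_Tc_mem i) _
  · refine Subalgebra.prod_mem _ fun i _ => ?_
    rw [← Finset.prod_inv_distrib]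
    refine Subalgebra.prod_mem _ fun j _ => ?_
    split_ifs with hij
    · rw [← inv_pow]; exact Subalgebra.pow_mem _ (inv_Tc_sub_Tc_mem hij) _
    · rw [inv_one]; exact Subalgebra.one_mem _

/-- **The transported integrand is in `𝒢_ℓ`.** [folklore] -/
theorem jac_mem : (fun r : Dcube => ∏ i : Fin ℓ, r.pr 0 i) ∈ 𝒢L ℓ := by
  have : (fun r : Dcube => ∏ i : Fin ℓ, r.pr 0 i) = ∏ i : Fin ℓ, fun r : Dcube => r.pr 0 i := by
    funext r; simp [Finset.prod_apply]
  rw [this]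
  exact Subalgebra.prod_mem _ fun i _ => pr_mem (le_of_lt i.isLt)

/-- **The transported integrand (with its Jacobian) is in `𝒢_ℓ`.** [cite: BrownENS2009, §2.2, Lemma 7.4 (mechanism)] -/
theorem GInt_mem (p : MvPolynomial (Fin ℓ) ℚ) (a : Fin ℓ → Fin ℓ → ℕ) (b c : Fin ℓ → ℕ) : GInt p a b c ∈ 𝒢L ℓ :=
  Subalgebra.mul_mem _ (Subalgebra.mul_mem _ jac_mem (aeval_Tc_mem p)) (inv_Den_mem a b c)

/-- Evaluation of `aeval` in the function algebra. [folklore] -/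
theorem aeval_apply (F : Fin ℓ → Dcube → ℝ) (p : MvPolynomial (Fin ℓ) ℚ) (r : Dcube) :
    (MvPolynomial.aeval F p) r = MvPolynomial.aeval (fun i => F i r) p := by
  have h := MvPolynomial.comp_aeval (R := ℚ) (f := F) (Pi.evalAlgHom ℚ (fun _ : Dcube => ℝ) r)
  have := congrArg (fun ψ : MvPolynomial (Fin ℓ) ℚ →ₐ[ℚ] ℝ => ψ p) h
  simpa using this

/-- **The transported integrand on the cube.** [folklore] -/
theorem GInt_ext {p : MvPolynomial (Fin ℓ) ℚ} {a : Fin ℓ → Fin ℓ → ℕ} {b c : Fin ℓ → ℕ} {x : Fin ℓ → ℝ} (hx : x ∈ cube ℓ) :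
    GInt p a b c (ext x) = (φc' x).det * gInt p a b c (φc x) := by
  have hT : (fun i => Tc i (ext x)) = φc x := by funext i; simp only [Tc]; rw [φc_eq_pr hx]
  have hTi : ∀ i, Tc i (ext x) = φc x i := fun i => congrFun hT i
  have hA : ∏ i : Fin ℓ, (ext x).pr 0 i = ∏ i : Fin ℓ, ∏ k ∈ Finset.Iio i, x k :=
    Finset.prod_congr rfl fun i _ => (prod_Iio_eq_pr hx i).symm
  have hD : Den a b c (ext x) =
      (∏ i, φc x i ^ b i) * (∏ i, (1 - φc x i) ^ c i) * ∏ i, ∏ j, if i < j then (φc x i - φc x j) ^ a i j else 1 := by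
    simp only [Den, Pi.mul_apply, Finset.prod_apply, Pi.pow_apply, Pi.sub_apply, Pi.one_apply, hTi]
    congr 1
    refine Finset.prod_congr rfl fun i _ => Finset.prod_congr rfl fun j _ => ?_
    split_ifs <;> simp [hTi]
  simp only [GInt, Pi.mul_apply, Pi.inv_apply, aeval_apply, hT, det_φc', gInt, div_eq_mul_inv, hA, hD]
  ring

/-- The case `ℓ = 0`. [folklore] -/
theorem integral_level_zero (p : MvPolynomial (Fin 0) ℚ) (a : Fin 0 → Fin 0 → ℕ) (b c : Fin 0 → ℕ) :
    (∫ t in KZ.openOrderedSimplex 0, gInt p a b c t) ∈ Fil 0 := by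
  classical
  have hvol : (volume : Measure (Fin 0 → ℝ)) = Measure.dirac (fun i => i.elim0) := by
    rw [MeasureTheory.volume_pi]; exact Measure.pi_of_empty _ _
  rw [hvol, setIntegral_dirac]
  split_ifs
  · have hx : (fun i : Fin 0 => (i.elim0 : ℝ)) = algebraMap ℚ ℝ ∘ fun i : Fin 0 => (i.elim0 : ℚ) := by
      funext i; exact i.elim0
    simp only [gInt, Finset.univ_eq_empty, Finset.prod_empty, mul_one, div_one]
    rw [hx, MvPolynomial.aeval_algebraMap_apply]
    exact (isRat_ratCast _).mem_iSup 0
  · exact Submodule.zero_mem _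

/-- **Brown's theorem for the standard cell** (real, simplicial coordinates): an absolutely convergent
integral over `{1 > t_0 > ⋯ > t_{ℓ-1} > 0}` of a regular form
`P(t)/(∏ t_i^{b_i} ∏ (1-t_i)^{c_i} ∏_{i<j} (t_i-t_j)^{a_ij}) dt`, `P ∈ ℚ[t]`, is a `ℚ`-linear
combination of multiple zeta values of weight at most `ℓ`.  Proof: cubical coordinates
`t_i = x_0 ⋯ x_i` carry the cell onto `(0,1)^ℓ` and the integrand (with its Jacobian) into the
algebra `𝒢_ℓ` generated by the `x_k^{±1}` and the `1/(1 - x_a ⋯ x_{b-1})`; integrating out the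
coordinates one at a time by the hyperlogarithm calculus (Theorem F₁ for families, the expansions at
`1` of Theorem T4, peeling), with Fubini, lands in `𝒵_{≤ ℓ}`. [cite: BrownENS2009, Thm 1.1, Lemma 7.4, Thm 8.2, Cor 8.3] -/
theorem genusZeroPeriodsMZV_proof : GenusZeroPeriodsMZV := by
  intro ℓ p a b c hint
  change IntegrableOn (gInt p a b c) (KZ.openOrderedSimplex ℓ) volume at hint
  change (∫ t in KZ.openOrderedSimplex ℓ, gInt p a b c t) ∈ Fil ℓ
  cases ℓ with
  | zero => exact integral_level_zero p a b c
  | succ n =>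
    rw [integral_simplex_eq_integral_cube]
    rw [integrableOn_simplex_iff] at hint
    have hid : ∀ x ∈ cube (n + 1), (φc' x).det * gInt p a b c (φc x) = GInt p a b c (ext x) :=
      fun x hx => (GInt_ext hx).symm
    rw [setIntegral_congr_fun (measurableSet_cube _) hid]
    exact integral_cube_mem (GInt_mem p a b c) (hint.congr_fun hid (measurableSet_cube _))

end Final

end Hyperlog

/-- **Brown's theorem (Goncharov–Manin conjecture) for the standard cell, discharged**: every
absolutely convergent integral over `{1 > t₀ > ⋯ > t_{ℓ-1} > 0}` of a regular `ℓ`-form on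
`𝔐_{0,ℓ+3}` defined over `ℚ` is a `ℚ`-linear combination of multiple zeta values of weight at most
`ℓ`.  The proof formalised here is Brown's (§8.3, Thm 8.2: integrate one variable at a time, the
fibre integrals being hyperlogarithms whose regularised values at `1` are again hyperlogarithms in
the next variable with multiple zeta value coefficients), run in cubical coordinates with the
hyperlogarithm calculus of layers I–XIII (`Hyperlog.genusZeroPeriodsMZV_proof`).
[cite: BrownENS2009, Thm 1.1, Lemma 7.4, Thm 8.2, Cor 8.3] -/
theorem GenusZeroPeriodsMZV_holds : GenusZeroPeriodsMZV := Hyperlog.genusZeroPeriodsMZV_proof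

end Literature.NumberTheory.Transcendental
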